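import Literature.Analysis.FluidPDE.VeryWeakToDistributional
import HarnessLib

/-!
# Very weak solutions of the mollified perturbed Leray system with a Riesz-type pressure are
  distributional solutions ([BT1], proof of Thm 2.4: "`∇(p_ε − p̃_ε) = 0`")

Analysis/FluidPDE proof file (theorems and three small definitions-free sections; one `def`, the
very weak integrand) in the DAG below the named fact
`Literature.Analysis.FluidPDE.bradshawTsai2017_thm_2_4_mollified` (`PeriodicLerayExistence.lean`;
Bradshaw–Tsai, Ann. Henri Poincaré 18 (2017) = arXiv:1510.07504 [BT1], Lemma 2.6 with the first
part of the proof of Thm 2.4: the mollified approximants `(U_ε, p_ε)`). That fact asks, besides the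
weak formulation of the mollified perturbed Leray system
`LU + (W + η_ε*U)·∇U + U·∇W + ∇p = −ℛ(W)` against divergence-free tests, for the **pressure-explicit
equation in the sense of distributions** (`IsMollifiedPeriodicWeakSolution.distributional`). In
print: "Note that `p_ε` is defined as a distribution whenever `U_ε` is a weak solution … On the
other hand, for `p̃_ε = Σ RᵢRⱼ[(η_ε*Uᵢ)Uⱼ + WᵢUⱼ + UᵢWⱼ + WᵢWⱼ]` … uniqueness for the forced
non-stationary Stokes system … implies `∇(p_ε − p̃_ε) = 0`. We may therefore replace `p_ε` by
`p̃_ε`." This file proves the corresponding statement over the tree's notions, with compactly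
supported objects only (no tempered distributions, no Stokes uniqueness), in the way the tree
treats the Navier–Stokes equations (`VeryWeakToDistributional.lean`,
`isDistributionalNSSolutionOn_slab_of_veryWeak`; Lemarié-Rieusset 2016, Lemma 6.3, (6.13),
Prop. 6.5):

* `BradshawTsai2017.distributional_of_veryWeak` — let `U, W, V ∈ L^{q}([a,b] × ℝ³)` for all
  `a < b` (`q ≥ 2` finite; in [BT1] `U = U_ε ∈ L^∞L²`, `W` the revised profile of Lemma 2.5 in
  `L^∞L^{10/3}`, `V = η_ε * U_ε`), `p ∈ L^{q_p}` of time slabs (`1 ≤ q_p < ∞`; `p̃_ε ∈ L^{5/3}`), put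
  `u = U + W`, `b = W + V`, and assume on `ℝ × ℝ³`: `div u = 0` weakly, the weak pressure Poisson
  equation `∫∫ p Δθ = −∫∫ (D²θ(b,U) + D²θ(u,W))` (`−Δp̃ = ∂ᵢ∂ⱼ(bᵢUⱼ + uᵢWⱼ)`, i.e. `p` is the Riesz
  pressure `p̃` above), and the very weak form of `∂ₛu − Δu − u − y·∇u + b·∇U + u·∇W + ∇p = 0`
  against test fields with divergence-free slices. Then the pressure-explicit identity — the
  `distributional` clause verbatim, with `V` for `mollify η ε U` — holds against every test field;
* `BradshawTsai2017.distributional_of_veryWeak_slices` — the same from slice-wise data in the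
  shape of `IsMollifiedPeriodicWeakSolution` / `IsRevisedProfile` (uniform `L²` slice bounds for
  `U`, `V`; `W ∈ C¹` with divergence-free slices and `‖W(s)‖_{L^q} ≤ C`; a.e. slice of `U` weakly
  divergence free; the slice-wise weak Poisson equation for a.e. `s`), by Fubini
  (`integral_inner_add_gradient_eq_zero_of_ae`, `integral_pressure_mul_laplacian_eq_of_ae`,
  `memLp_slab_of_forall_lintegral_le`).

## The argument

As in `VeryWeakToDistributional.lean`: for a test field `ψ` and `r > 0` the corrected field
`w_r = ψ − ∇N_{r/2,r}[div ψ] − e_{r/2,r}[ψ]` (`correctedTestField`; truncated Newtonian potential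
`N`, smoothing remainder `Λ[g] = λ_{r/2,r} ⋆ g`, corrector `e[ψ] = λ ⋆ ψ`, `ΔN[g] = g − Λ[g]`) is an
admissible divergence-free test field. **The gradient part is exact for the Leray operator too**
(`integral_lerayVeryWeakIntegrand_gradient`): besides `∂ₛ∇φ = ∇∂ₛφ` and `Δ∇φ = ∇Δφ`, the
zeroth-order and dilation terms give `2∇φ + (y·∇)∇φ = ∇(φ + y·∇φ)`
(`inner_two_smul_gradient_add_fderiv_gradient_self`, Schwarz), again a compactly supported
gradient killed by `div u = 0`; the drift terms are the Hessian pairings `D²φ(b,U) + D²φ(u,W)`,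
which the weak Poisson equation converts into `−∫∫ p Δφ = −∫∫ p div ψ + ∫∫ p Λ_r[div ψ]`. Hence
`∫∫ W(ψ) + p div ψ = ∫∫ p Λ_r[div ψ] + ∫∫ W(e_r[ψ])` for every `r > 0`. **The remainders vanish
as `r → ∞`**: on the box `[a,b] × B̄(0, R₀ + r)` carrying them, `Λ_r`, `e_r`, `∂ₛe_r`, `Δe_r` are
`O(r⁻³)`, and — the new point forced by the dilation term `y·∇` against the profile
`W ∉ L²` — the *gradient* of the corrector is `O(r⁻⁴)` (`exists_norm_fderiv_farSmoothingField_le`,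
from the kernel-gradient bound `‖Dλ_{r/2,r}‖ ≤ S/r⁴`, `exists_forall_norm_fderiv_newtonFarLaplacian_half_le`,
the scaling law `λ_{r/2,r} = r⁻³λ_{1/2,1}(·/r)` differentiated), so that `|y| |De_r| = O(r⁻³)` on the
box (`|y| ≤ 2r`); every term is then a box majorant `1_box |F| C/rᵏ` with `F ∈ L^q` of the time
slab (`F ∈ {U, W, p}`, `k = 3`, or `F ∈ {|U|², |W|², |V|²}`, `k = 4`, after Young's inequality
for the products), and `∫∫ 1_box |F| C/rᵏ = O(r^{3/q' − k}) → 0` by Hölder against the volume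
`O(r³)` of the box (`tendsto_integral_of_box_bound_memLp`, `q ≥ 1`, `k ≥ 3`).

## Contents

* kernel and corrector gradient bounds at scale `r`; support boxes of test fields on `ℝ × ℝ³`;
* the vanishing lemmas for box-supported remainders (`L^q` majorant with `q > 1`, `L¹` majorant,
  the unified `MemLp` form), local integrability and slab classes from uniform slice bounds;
* slice calculus: `⟪v, D(∇θ) w⟫ = D²θ(w, v)`, `D(y ↦ Dφ(y)y)`, `2∇φ + (y·∇)∇φ = ∇(φ + y·∇φ)`,
  `φ + y·∇φ` is a test function;
* `BradshawTsai2017.lerayVeryWeakIntegrand` (the pressure-free integrand of the `distributional`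
  clause), its linearity and integrability, the gradient identity, the two remainder limits,
  the main theorem and its slice-wise form.

## Mathlib / tree search

Tree (all used): `correctedTestField`, `isDivFree_correctedTestField`, `farSmoothingField`,
`timeDeriv_farSmoothingField`, `laplacian_farSmoothingField`, `exists_norm_farSmoothingField_slice_le`,
`farSmoothingField_slice_eq_zero_of_notMem`, `newtonFarSmoothing_slice_eq_zero_of_notMem`,
`exists_abs_newtonFarSmoothing_slice_le`, `IsSpaceTimeTestOn.newtonNearPotential_top/
newtonFarSmoothing_top/divergence_isSpaceTimeTestOn/add/sub/clm_left/smul_const/finsetSum`,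
`setLIntegral_le_lintegral_rpow_mul_measure_rpow`, `volume_Icc_prod_closedBall`,
`contDiff_inner_const_left` (`VeryWeakToDistributional`); `newtonFarLaplacian_scale`
(`NewtonPotential`); `fderiv_newtonFarSmoothing_eq_integral_kernel`, `laplacian_newtonNearPotential`,
`contDiff_newtonFarSmoothing` (`NewtonLocalPotential`); `inner_fderiv_gradient_apply`,
`laplacian_gradient`, `IsSpaceTimeTestOn.timeDeriv_gradient/gradient_isSpaceTimeTestOn`,
`laplacian_slice_eq_zero_of_notMem_tsupport` (`DistributionalPressurePoisson`);
`integrable_inner_of_locallyIntegrableOn`, `integrable_mul_of_locallyIntegrableOn`,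
`IsSpaceTimeTestOn.continuous_gradient_field/continuous_divergence_field` (`SuitableWeakPressure`);
`IsSpaceTimeTestOn.timeDeriv_top/laplacian_top/fderiv_top/exists_norm_le/exists_time_support`
(`HeatDuhamelBack`); `VectorCalculus.IsDivFree.isWeaklyDivFree_holds` (`VectorCalculus`).
`lean search 'lerayVeryWeak|distributional_of_veryWeak|norm_fderiv_newtonFarLaplacian'`: nothing;
the tree's passage very weak → distributional exists for Navier–Stokes on slabs
(`isDistributionalNSSolutionOn_slab_of_veryWeak`) and on the torus
(`Torus.IsWeakNSSolutionOn.isDistributionalNSSolutionOn_of_pressure`), not for the (mollified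
perturbed) Leray system. Mathlib: `HasFDerivAt.clm_apply`, `ContDiffAt.isSymmSndFDerivAt`,
`integral_prod`, `norm_integral_le_of_norm_le`, `MemLp.mono_exponent`, `MemLp.norm_rpow_div`,
`Measure.prod_restrict`, `tendsto_pow_atTop`, `tendsto_rpow_neg_atTop`.

## References

* Z. Bradshaw, T.-P. Tsai, *Forward discretely self-similar solutions of the Navier–Stokes
  equations II*, Ann. Henri Poincaré 18 (2017) 1095–1119 = arXiv:1510.07504, §2, proof of
  Thm 2.4 (the pressure `p̃_ε` and "`∇(p_ε − p̃_ε) = 0`") [BradshawTsai2017AHP].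
* P. G. Lemarié-Rieusset, *The Navier–Stokes Problem in the 21st Century*, CRC Press 2016,
  Lemma 6.3, (6.13), Prop. 6.5 with Def. 6.9 (the Navier–Stokes model of the argument)
  [LemarieRieusset2016].
-/

noncomputable section

open MeasureTheory Set Function Filter Topology TopologicalSpace InnerProductSpace Metric
open scoped Laplacian RealInnerProductSpace NNReal ENNReal ContDiff

namespace Literature.Analysis.FluidPDE

/-- Local notation for physical space `ℝ³ = EuclideanSpace ℝ (Fin 3)`. -/
local notation "ℝ³" => EuclideanSpace ℝ (Fin 3)

/-- Local notation for the standard orthonormal frame of `ℝ³`. -/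
local notation "𝐛" => EuclideanSpace.basisFun (Fin 3) ℝ

/-! ### The gradient of the regularised Laplacian kernel is `O(r⁻⁴)` at scale `r` -/

section KernelGradient

/-- **The gradient of the regularised Laplacian kernel is `O(r⁻⁴)` in sup norm at scale `r`:**
there is `S ≥ 0` with `‖Dλ_{r/2,r}(z)‖ ≤ S / r⁴` for all `r > 0` and `z` (the scaling law
`λ_{r/2,r}(z) = r⁻³ λ_{1/2,1}(z/r)` differentiated, and boundedness of the continuous compactly
supported `Dλ_{1/2,1}`). [folklore] -/
theorem exists_forall_norm_fderiv_newtonFarLaplacian_half_le :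
    ∃ S : ℝ, 0 ≤ S ∧ ∀ ⦃r : ℝ⦄, 0 < r → ∀ z : ℝ³,
      ‖fderiv ℝ (newtonFarLaplacian (r / 2) r) z‖ ≤ S / r ^ 4 := by
  have h₀ : (0 : ℝ) < 1 / 2 := by norm_num
  have h₁ : (1 / 2 : ℝ) < 1 := by norm_num
  have hcd : ContDiff ℝ 1 (newtonFarLaplacian (1 / 2 : ℝ) 1) := contDiff_newtonFarLaplacian h₀ h₁
  have hc : Continuous (fderiv ℝ (newtonFarLaplacian (1 / 2 : ℝ) 1)) :=
    hcd.continuous_fderiv one_ne_zero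
  have hcs : HasCompactSupport (fderiv ℝ (newtonFarLaplacian (1 / 2 : ℝ) 1)) :=
    (hasCompactSupport_newtonFarLaplacian h₀.le h₁).fderiv ℝ
  obtain ⟨S, hS⟩ := hc.bounded_above_of_compact_support hcs
  refine ⟨max S 0, le_max_right _ _, fun r hr z => ?_⟩
  have e : newtonFarLaplacian (r / 2) r =
      fun z => r⁻¹ ^ 3 * newtonFarLaplacian (1 / 2) 1 (r⁻¹ • z) := by
    funext z
    have := newtonFarLaplacian_scale hr (1 / 2) 1 z
    rw [mul_one, show r * (1 / 2) = r / 2 by ring] at this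
    exact this
  have hd : DifferentiableAt ℝ (newtonFarLaplacian (1 / 2 : ℝ) 1) (r⁻¹ • z) :=
    (hcd.differentiable one_ne_zero) _
  have hsm : HasFDerivAt (fun z : ℝ³ => r⁻¹ • z) (r⁻¹ • ContinuousLinearMap.id ℝ ℝ³) z :=
    (hasFDerivAt_id z).const_smul r⁻¹
  have hcomp : HasFDerivAt (fun z : ℝ³ => newtonFarLaplacian (1 / 2) 1 (r⁻¹ • z))
      ((fderiv ℝ (newtonFarLaplacian (1 / 2) 1) (r⁻¹ • z)).comp
        (r⁻¹ • ContinuousLinearMap.id ℝ ℝ³)) z :=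
    hd.hasFDerivAt.comp z hsm
  have hfull : HasFDerivAt (newtonFarLaplacian (r / 2) r)
      (r⁻¹ ^ 3 • ((fderiv ℝ (newtonFarLaplacian (1 / 2) 1) (r⁻¹ • z)).comp
        (r⁻¹ • ContinuousLinearMap.id ℝ ℝ³))) z := by
    rw [e]
    exact hcomp.const_mul (r⁻¹ ^ 3)
  rw [hfull.fderiv]
  have hb : ‖fderiv ℝ (newtonFarLaplacian (1 / 2) 1) (r⁻¹ • z)‖ ≤ max S 0 :=
    (hS (r⁻¹ • z)).trans (le_max_left _ _)
  have hr0 : 0 ≤ r⁻¹ := inv_nonneg.2 hr.le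
  calc ‖r⁻¹ ^ 3 • ((fderiv ℝ (newtonFarLaplacian (1 / 2) 1) (r⁻¹ • z)).comp
          (r⁻¹ • ContinuousLinearMap.id ℝ ℝ³))‖
      ≤ ‖r⁻¹ ^ 3‖ * (‖fderiv ℝ (newtonFarLaplacian (1 / 2) 1) (r⁻¹ • z)‖ *
          ‖r⁻¹ • ContinuousLinearMap.id ℝ ℝ³‖) := by
        rw [norm_smul]
        exact mul_le_mul_of_nonneg_left (ContinuousLinearMap.opNorm_comp_le _ _) (norm_nonneg _)
    _ ≤ r⁻¹ ^ 3 * (max S 0 * r⁻¹) := by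
        rw [Real.norm_eq_abs, abs_of_nonneg (pow_nonneg hr0 3)]
        refine mul_le_mul_of_nonneg_left (mul_le_mul hb ?_ (norm_nonneg _) (le_max_right _ _))
          (pow_nonneg hr0 3)
        rw [norm_smul, Real.norm_eq_abs, abs_of_nonneg hr0]
        exact mul_le_of_le_one_right hr0 ContinuousLinearMap.norm_id_le
    _ = max S 0 / r ^ 4 := by
        rw [div_eq_mul_inv, ← inv_pow]; ring

/-- **Gradient bound for the smoothing remainder at scale `r`:** `‖DΛ_{r/2,r}[g](x)‖ ≤ (S/r⁴) ∫|g|`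
for continuous compactly supported `g`, with `S` as in
`exists_forall_norm_fderiv_newtonFarLaplacian_half_le` (the derivative falls on the kernel,
`fderiv_newtonFarSmoothing_eq_integral_kernel`). [folklore] -/
theorem norm_fderiv_newtonFarSmoothing_half_le {S : ℝ} (hS0 : 0 ≤ S)
    (hS : ∀ ⦃r : ℝ⦄, 0 < r → ∀ z : ℝ³, ‖fderiv ℝ (newtonFarLaplacian (r / 2) r) z‖ ≤ S / r ^ 4)
    {r : ℝ} (hr : 0 < r) {g : ℝ³ → ℝ} (hg : Continuous g) (hgc : HasCompactSupport g) (x : ℝ³) :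
    ‖fderiv ℝ (newtonFarSmoothing (r / 2) r g) x‖ ≤ S / r ^ 4 * ∫ z, |g z| := by
  have h₀ : 0 < r / 2 := half_pos hr
  have h₁ : r / 2 < r := half_lt_self hr
  have hI : 0 ≤ ∫ z, |g z| := integral_nonneg fun z => abs_nonneg _
  refine ContinuousLinearMap.opNorm_le_bound _ (by positivity) fun a => ?_
  rw [fderiv_newtonFarSmoothing_eq_integral_kernel h₀ h₁ hg hgc x a, Real.norm_eq_abs]
  have hga : Integrable fun y => |g y| := (hg.integrable_of_hasCompactSupport hgc).abs
  calc |∫ y, g y * fderiv ℝ (newtonFarLaplacian (r / 2) r) (x - y) a|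
      ≤ ∫ y, |g y * fderiv ℝ (newtonFarLaplacian (r / 2) r) (x - y) a| :=
        abs_integral_le_integral_abs
    _ ≤ ∫ y, |g y| * (S / r ^ 4 * ‖a‖) := by
        refine integral_mono_of_nonneg (Eventually.of_forall fun y => abs_nonneg _)
          (hga.mul_const _) (Eventually.of_forall fun y => ?_)
        dsimp only
        rw [abs_mul]
        refine mul_le_mul_of_nonneg_left ?_ (abs_nonneg _)
        rw [← Real.norm_eq_abs]
        exact (ContinuousLinearMap.le_opNorm _ _).trans
          (mul_le_mul_of_nonneg_right (hS hr _) (norm_nonneg _))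
    _ = S / r ^ 4 * (∫ z, |g z|) * ‖a‖ := by
        rw [integral_mul_const]; ring

/-- The `L¹` norms of the slices of a space–time test function are uniformly bounded. [folklore] -/
theorem IsSpaceTimeTestOn.exists_integral_abs_slice_le {θ : ℝ → ℝ³ → ℝ}
    (hθ : IsSpaceTimeTestOn (⊤ : Opens (ℝ × ℝ³)) θ) :
    ∃ L : ℝ, 0 ≤ L ∧ ∀ t, ∫ z, |θ t z| ≤ L := by
  obtain ⟨M, hM0, hM⟩ := hθ.exists_norm_le
  obtain ⟨K, hK, hKt⟩ := hθ.exists_compact_slice_subset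
  have hvol : volume K < (⊤ : ℝ≥0∞) := hK.measure_lt_top
  set V : ℝ := (volume K).toReal with hV
  have hint : ∀ t, Integrable (θ t) := fun t =>
    (hθ.contDiff_slice t).continuous.integrable_of_hasCompactSupport (hθ.hasCompactSupport_slice t)
  refine ⟨M * V, by positivity, fun t => ?_⟩
  have hsupp : support (fun z => |θ t z|) ⊆ K := fun z hz => by
    rw [mem_support, ne_eq, abs_eq_zero] at hz
    exact hKt t (subset_tsupport _ hz)
  calc ∫ z, |θ t z| = ∫ z in K, |θ t z| :=
        (setIntegral_eq_integral_of_forall_compl_eq_zero fun z hz =>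
          notMem_support.1 fun h => hz (hsupp h)).symm
    _ ≤ ∫ _ in K, M := by
        refine setIntegral_mono_on (hint t).abs.integrableOn ?_ hK.measurableSet fun z _ => ?_
        · exact integrableOn_const (hs := hvol.ne) (hC := by simp)
        · rw [← Real.norm_eq_abs]; exact hM t z
    _ = M * V := by
        rw [setIntegral_const, smul_eq_mul, mul_comm, hV, Measure.real]

/-- **Uniform `O(r⁻⁴)` bound for the gradient of the corrector** of a space–time test field:
`‖De_{r/2,r}[χ(t)](x)‖ ≤ C/r⁴` for all `t`, `x`, `r > 0` (the derivative falls on the kernel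
`λ_{r/2,r}`, whose gradient is `O(r⁻⁴)`). [folklore] -/
theorem exists_norm_fderiv_farSmoothingField_le {χ : ℝ → ℝ³ → ℝ³}
    (hχ : IsSpaceTimeTestOn (⊤ : Opens (ℝ × ℝ³)) χ) :
    ∃ C : ℝ, 0 ≤ C ∧ ∀ ⦃r : ℝ⦄, 0 < r → ∀ t x,
      ‖fderiv ℝ (farSmoothingField (r / 2) r (χ t)) x‖ ≤ C / r ^ 4 := by
  obtain ⟨S, hS0, hS⟩ := exists_forall_norm_fderiv_newtonFarLaplacian_half_le
  have hχi : ∀ i, IsSpaceTimeTestOn (⊤ : Opens (ℝ × ℝ³)) fun t y => ⟪𝐛 i, χ t y⟫ := fun i =>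
    hχ.clm_left (innerSL ℝ (𝐛 i))
  choose L hL0 hL using fun i => (hχi i).exists_integral_abs_slice_le
  refine ⟨∑ i, S * L i, Finset.sum_nonneg fun i _ => mul_nonneg hS0 (hL0 i), fun r hr t x => ?_⟩
  have h₀ : 0 < r / 2 := half_pos hr
  have h₁ : r / 2 < r := half_lt_self hr
  have hci : ∀ i, ContDiff ℝ 1 fun y => ⟪𝐛 i, χ t y⟫ := fun i =>
    contDiff_inner_const_left ((hχ.contDiff_slice t).of_le (by norm_cast)) _
  have hcc : ∀ i, HasCompactSupport fun y => ⟪𝐛 i, χ t y⟫ := fun i =>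
    (hχi i).hasCompactSupport_slice t
  have hΛi : ∀ i, ContDiff ℝ 1 (newtonFarSmoothing (r / 2) r fun y => ⟪𝐛 i, χ t y⟫) := fun i =>
    contDiff_newtonFarSmoothing h₀ h₁ 1 (hci i)
  have hd : ∀ i ∈ Finset.univ, DifferentiableAt ℝ
      (fun x => newtonFarSmoothing (r / 2) r (fun y => ⟪𝐛 i, χ t y⟫) x • 𝐛 i) x := fun i _ =>
    (((hΛi i).differentiable one_ne_zero) x).smul_const _
  have e : farSmoothingField (r / 2) r (χ t) =
      fun x => ∑ i, newtonFarSmoothing (r / 2) r (fun y => ⟪𝐛 i, χ t y⟫) x • 𝐛 i := rfl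
  rw [e, fderiv_fun_sum hd, Finset.sum_div]
  refine (norm_sum_le _ _).trans (Finset.sum_le_sum fun i _ => ?_)
  rw [fderiv_smul_const (((hΛi i).differentiable one_ne_zero) x)]
  calc ‖(fderiv ℝ (newtonFarSmoothing (r / 2) r fun y => ⟪𝐛 i, χ t y⟫) x).smulRight (𝐛 i)‖
      ≤ ‖fderiv ℝ (newtonFarSmoothing (r / 2) r fun y => ⟪𝐛 i, χ t y⟫) x‖ * ‖(𝐛 : OrthonormalBasis (Fin 3) ℝ ℝ³) i‖ :=
        (ContinuousLinearMap.norm_smulRight_apply _ _).le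
    _ = ‖fderiv ℝ (newtonFarSmoothing (r / 2) r fun y => ⟪𝐛 i, χ t y⟫) x‖ := by
        rw [(EuclideanSpace.basisFun (Fin 3) ℝ).orthonormal.1 i, mul_one]
    _ ≤ S / r ^ 4 * ∫ z, |⟪𝐛 i, χ t z⟫| :=
        norm_fderiv_newtonFarSmoothing_half_le hS0 hS hr (hci i).continuous (hcc i) x
    _ ≤ S / r ^ 4 * L i := mul_le_mul_of_nonneg_left (hL i t) (by positivity)
    _ = S * L i / r ^ 4 := by ring

end KernelGradient

/-! ### Support boxes of test fields on `ℝ × ℝ³`, and the vanishing of box-supported remainders -/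

section Vanishing

/-- The support box of a space–time test field on `ℝ × ℝ³`: a compact time interval `[a, b]`
and a ball radius `R₀ ≥ 0`. [folklore] -/
theorem IsSpaceTimeTestOn.exists_tsupport_subset_box_top {F : Type*} [NormedAddCommGroup F]
    [NormedSpace ℝ F] {ψ : ℝ → ℝ³ → F} (hψ : IsSpaceTimeTestOn (⊤ : Opens (ℝ × ℝ³)) ψ) :
    ∃ a b R₀ : ℝ, 0 ≤ R₀ ∧ tsupport (uncurry ψ) ⊆ Icc a b ×ˢ closedBall (0 : ℝ³) R₀ := by
  obtain ⟨a, b, hsupp⟩ := hψ.exists_time_support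
  obtain ⟨R₀, hR₀, hR⟩ := hψ.exists_forall_eq_zero_of_lt_norm_slice
  refine ⟨a, b, R₀, hR₀, closure_minimal ?_ (isClosed_Icc.prod isClosed_closedBall)⟩
  rintro ⟨t, x⟩ hz
  rw [mem_support] at hz
  refine ⟨?_, ?_⟩
  · by_contra ht
    exact hz (by simp [uncurry, hsupp t ht])
  · rw [mem_closedBall_zero_iff]
    by_contra hx
    exact hz (hR t x (not_le.1 hx))

/-- **Vanishing of box-supported remainders, `L^q` majorant with `q > 1`.** Let
`F ∈ L^q([a, b] × ℝ³)`, `1 < q < ∞` (conjugate exponent `q'`), and let `Φ_r`, `r ≥ r₁`, be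
functions on `ℝ × ℝ³` with `|Φ_r| ≤ |F| · C/r³` on the box `[a, b] × B̄(0, R₀ + r)` and `Φ_r = 0`
off it (`C ≥ 0`). Then `∫∫ Φ_r → 0` as `r → ∞`: by Hölder,
`|∫∫ Φ_r| ≤ (C/r³) ‖F‖_q ((b-a) |B̄(0,R₀+r)|)^{1/q'} = O(r^{3/q' - 3})` and `3/q' < 3` (the
whole-space twin of the tree's `tendsto_setIntegral_slab_of_bound`). [folklore] -/
theorem tendsto_integral_of_box_bound {G : Type*} [NormedAddCommGroup G] {F : ℝ × ℝ³ → G}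
    {q q' : ℝ} (hqq' : q.HolderConjugate q') {a b : ℝ}
    (hFm : AEMeasurable (fun z => ‖F z‖ₑ) (volume.restrict (Icc a b ×ˢ (univ : Set ℝ³))))
    (hFq : ∫⁻ z in Icc a b ×ˢ (univ : Set ℝ³), ‖F z‖ₑ ^ q < ⊤)
    {Φ : ℝ → ℝ × ℝ³ → ℝ} {C R₀ r₁ : ℝ} (hC : 0 ≤ C) (hR₀ : 0 ≤ R₀)
    (hbound : ∀ r, r₁ ≤ r → ∀ z ∈ Icc a b ×ˢ closedBall (0 : ℝ³) (R₀ + r),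
      ‖Φ r z‖ ≤ ‖F z‖ * (C / r ^ 3))
    (hzero : ∀ r, r₁ ≤ r → ∀ z ∉ Icc a b ×ˢ closedBall (0 : ℝ³) (R₀ + r), Φ r z = 0) :
    Tendsto (fun r => ∫ z, Φ r z) atTop (𝓝 0) := by
  set μ' : Measure (ℝ × ℝ³) := volume.restrict (Icc a b ×ˢ (univ : Set ℝ³)) with hμ'
  set I : ℝ≥0∞ := ∫⁻ z, ‖F z‖ₑ ^ q ∂μ' with hI
  set V₁ : ℝ≥0∞ := volume (ball (0 : ℝ³) 1) with hV₁
  have hV₁top : V₁ < ⊤ := measure_ball_lt_top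
  have hq : 0 < q := hqq'.pos
  have hq' : 0 < q' := hqq'.symm.pos
  have hq'1 : 1 < q' := hqq'.symm.lt
  -- the real majorant
  set K : ℝ := C * (I ^ (1 / q)).toReal *
    ((ENNReal.ofReal (b - a) * (ENNReal.ofReal 8 * V₁)) ^ (1 / q')).toReal with hK
  have hK0 : 0 ≤ K := by positivity
  -- the integral lives on the slab
  have hslab : ∀ r, r₁ ≤ r → ∫ z, Φ r z = ∫ z in Icc a b ×ˢ (univ : Set ℝ³), Φ r z := by
    intro r hr
    refine (setIntegral_eq_integral_of_forall_compl_eq_zero fun z hz => hzero r hr z fun h => hz ?_).symm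
    exact ⟨h.1, mem_univ _⟩
  -- the bound `‖∫ Φ_r‖ ≤ K * r^{3/q' - 3}` for `r ≥ max r₁ (max R₀ 1)`
  have key : ∀ r, max r₁ (max R₀ 1) ≤ r → ‖∫ z, Φ r z‖ ≤ K * r ^ (3 / q' - 3) := by
    intro r hr
    have hr₁ : r₁ ≤ r := (le_max_left _ _).trans hr
    have hrR : max R₀ 1 ≤ r := (le_max_right _ _).trans hr
    have hr1 : 1 ≤ r := (le_max_right _ _).trans hrR
    have hr0 : 0 < r := one_pos.trans_le hr1
    have hRr : R₀ ≤ r := (le_max_left _ _).trans hrR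
    set B : Set (ℝ × ℝ³) := Icc a b ×ˢ closedBall (0 : ℝ³) (R₀ + r) with hB
    have hBm : MeasurableSet B := measurableSet_Icc.prod measurableSet_closedBall
    -- Step 1: domination by the indicator of the box
    have hpt : ∀ z, ‖Φ r z‖ₑ ≤ B.indicator (fun z => ENNReal.ofReal (C / r ^ 3) * ‖F z‖ₑ) z := by
      intro z
      by_cases hz : z ∈ B
      · rw [indicator_of_mem hz, ← ofReal_norm, ← ofReal_norm, ← ENNReal.ofReal_mul (by positivity),
          mul_comm]
        exact ENNReal.ofReal_le_ofReal (hbound r hr₁ z hz)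
      · rw [indicator_of_notMem hz, hzero r hr₁ z hz, enorm_zero]
    have h1 : ∫⁻ z, ‖Φ r z‖ₑ ∂μ' ≤ ENNReal.ofReal (C / r ^ 3) * ∫⁻ z in B, ‖F z‖ₑ ∂μ' := by
      calc ∫⁻ z, ‖Φ r z‖ₑ ∂μ' ≤ ∫⁻ z, B.indicator (fun z => ENNReal.ofReal (C / r ^ 3) * ‖F z‖ₑ) z ∂μ' :=
            lintegral_mono hpt
        _ = ENNReal.ofReal (C / r ^ 3) * ∫⁻ z in B, ‖F z‖ₑ ∂μ' := by
            rw [lintegral_indicator hBm, lintegral_const_mul'' _ hFm.restrict]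
    -- Step 2: Hölder against the box
    have h2 : ∫⁻ z in B, ‖F z‖ₑ ∂μ' ≤ I ^ (1 / q) * μ' B ^ (1 / q') :=
      setLIntegral_le_lintegral_rpow_mul_measure_rpow hFm hBm hqq'
    -- Step 3: the volume of the box
    have h3 : μ' B ≤ ENNReal.ofReal (b - a) * (ENNReal.ofReal 8 * V₁) * ENNReal.ofReal (r ^ 3) := by
      calc μ' B ≤ volume B := Measure.restrict_apply_le _ _
        _ = ENNReal.ofReal (b - a) * (ENNReal.ofReal ((R₀ + r) ^ 3) * V₁) :=
            volume_Icc_prod_closedBall a b (by linarith)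
        _ ≤ ENNReal.ofReal (b - a) * (ENNReal.ofReal ((2 * r) ^ 3) * V₁) := by
            gcongr; linarith
        _ = ENNReal.ofReal (b - a) * (ENNReal.ofReal 8 * V₁) * ENNReal.ofReal (r ^ 3) := by
            rw [show (2 * r) ^ 3 = 8 * r ^ 3 by ring, ENNReal.ofReal_mul (by norm_num)]; ring
    have h3' : μ' B ^ (1 / q') ≤
        (ENNReal.ofReal (b - a) * (ENNReal.ofReal 8 * V₁)) ^ (1 / q') * ENNReal.ofReal (r ^ (3 / q')) := by
      calc μ' B ^ (1 / q') ≤ (ENNReal.ofReal (b - a) * (ENNReal.ofReal 8 * V₁) * ENNReal.ofReal (r ^ 3)) ^ (1 / q') :=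
            ENNReal.rpow_le_rpow h3 (by positivity)
        _ = (ENNReal.ofReal (b - a) * (ENNReal.ofReal 8 * V₁)) ^ (1 / q') *
              ENNReal.ofReal (r ^ 3) ^ (1 / q') := ENNReal.mul_rpow_of_nonneg _ _ (by positivity)
        _ = _ := by
            have e3 : (r ^ 3) ^ (1 / q') = r ^ (3 / q') := by
              rw [show r ^ 3 = r ^ (3 : ℝ) by exact_mod_cast (Real.rpow_natCast r 3).symm,
                ← Real.rpow_mul hr0.le]
              congr 1; ring
            rw [ENNReal.ofReal_rpow_of_pos (by positivity), e3]
    -- Step 4: assemble in `ℝ`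
    have hItop : I ^ (1 / q) ≠ ⊤ := ENNReal.rpow_ne_top_of_nonneg (by positivity) hFq.ne
    have hWtop : (ENNReal.ofReal (b - a) * (ENNReal.ofReal 8 * V₁)) ^ (1 / q') ≠ ⊤ :=
      ENNReal.rpow_ne_top_of_nonneg (by positivity) (ENNReal.mul_ne_top ENNReal.ofReal_ne_top
        (ENNReal.mul_ne_top ENNReal.ofReal_ne_top hV₁top.ne))
    have h4 : ∫⁻ z, ‖Φ r z‖ₑ ∂μ' ≤ ENNReal.ofReal (C / r ^ 3) * (I ^ (1 / q) *
        ((ENNReal.ofReal (b - a) * (ENNReal.ofReal 8 * V₁)) ^ (1 / q') * ENNReal.ofReal (r ^ (3 / q')))) :=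
      h1.trans (mul_le_mul_right (h2.trans (mul_le_mul_right h3' _)) _)
    have h5 : (ENNReal.ofReal (C / r ^ 3) * (I ^ (1 / q) *
        ((ENNReal.ofReal (b - a) * (ENNReal.ofReal 8 * V₁)) ^ (1 / q') * ENNReal.ofReal (r ^ (3 / q'))))).toReal =
        K * r ^ (3 / q' - 3) := by
      have e3 : r ^ (3 / q' - 3) = r ^ (3 / q') / r ^ 3 := by
        rw [Real.rpow_sub hr0]; congr 1; exact_mod_cast Real.rpow_natCast r 3
      rw [ENNReal.toReal_mul, ENNReal.toReal_mul, ENNReal.toReal_mul, ENNReal.toReal_ofReal (by positivity),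
        ENNReal.toReal_ofReal (by positivity), hK, e3]
      ring
    calc ‖∫ z, Φ r z‖ = ‖∫ z in Icc a b ×ˢ (univ : Set ℝ³), Φ r z‖ := by rw [hslab r hr₁]
      _ ≤ (∫⁻ z, ENNReal.ofReal ‖Φ r z‖ ∂μ').toReal := norm_integral_le_lintegral_norm _
      _ = (∫⁻ z, ‖Φ r z‖ₑ ∂μ').toReal := by simp only [ofReal_norm]
      _ ≤ K * r ^ (3 / q' - 3) := by
          rw [← h5]
          exact ENNReal.toReal_mono (ENNReal.mul_ne_top ENNReal.ofReal_ne_top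
            (ENNReal.mul_ne_top hItop (ENNReal.mul_ne_top hWtop ENNReal.ofReal_ne_top))) h4
  -- conclusion: `K r^{3/q' - 3} → 0`
  have hexp : 3 / q' - 3 < 0 := by
    have : 3 / q' < 3 := by rw [div_lt_iff₀ hq']; nlinarith
    linarith
  have hlim : Tendsto (fun r : ℝ => K * r ^ (3 / q' - 3)) atTop (𝓝 0) := by
    have h := (tendsto_rpow_neg_atTop (y := -(3 / q' - 3)) (by linarith)).const_mul K
    rw [mul_zero] at h
    refine h.congr' ?_
    filter_upwards [eventually_gt_atTop 0] with r hr
    rw [neg_neg]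
  refine squeeze_zero_norm' ?_ hlim
  filter_upwards [eventually_ge_atTop (max r₁ (max R₀ 1))] with r hr
  exact key r hr

/-- **Vanishing of box-supported remainders, `L¹` majorant.** Let `F ∈ L¹([a, b] × ℝ³)` and let
`Φ_r`, `r ≥ r₁`, satisfy `|Φ_r| ≤ |F| · C/rᵏ` (`k ≥ 1`, `C ≥ 0`) on the box
`[a, b] × B̄(0, R₀ + r)` and `Φ_r = 0` off it. Then `∫∫ Φ_r → 0` (`|∫∫ Φ_r| ≤ (C/rᵏ) ‖F‖₁`).
[folklore] -/
theorem tendsto_integral_of_box_bound_one {G : Type*} [NormedAddCommGroup G] {F : ℝ × ℝ³ → G}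
    {a b : ℝ} (hF1 : ∫⁻ z in Icc a b ×ˢ (univ : Set ℝ³), ‖F z‖ₑ < ⊤)
    {Φ : ℝ → ℝ × ℝ³ → ℝ} {C R₀ r₁ : ℝ} {k : ℕ} (hk : 1 ≤ k) (hC : 0 ≤ C)
    (hbound : ∀ r, r₁ ≤ r → ∀ z ∈ Icc a b ×ˢ closedBall (0 : ℝ³) (R₀ + r),
      ‖Φ r z‖ ≤ ‖F z‖ * (C / r ^ k))
    (hzero : ∀ r, r₁ ≤ r → ∀ z ∉ Icc a b ×ˢ closedBall (0 : ℝ³) (R₀ + r), Φ r z = 0) :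
    Tendsto (fun r => ∫ z, Φ r z) atTop (𝓝 0) := by
  set μ' : Measure (ℝ × ℝ³) := volume.restrict (Icc a b ×ˢ (univ : Set ℝ³)) with hμ'
  set I : ℝ≥0∞ := ∫⁻ z, ‖F z‖ₑ ∂μ' with hI
  have hslab : ∀ r, r₁ ≤ r → ∫ z, Φ r z = ∫ z in Icc a b ×ˢ (univ : Set ℝ³), Φ r z := by
    intro r hr
    refine (setIntegral_eq_integral_of_forall_compl_eq_zero fun z hz => hzero r hr z fun h => hz ?_).symm
    exact ⟨h.1, mem_univ _⟩
  have key : ∀ r, max r₁ 1 ≤ r → ‖∫ z, Φ r z‖ ≤ C * I.toReal * (r ^ k)⁻¹ := by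
    intro r hr
    have hr₁ : r₁ ≤ r := (le_max_left _ _).trans hr
    have hr1 : 1 ≤ r := (le_max_right _ _).trans hr
    have hr0 : 0 < r := one_pos.trans_le hr1
    have hpt : ∀ z, ‖Φ r z‖ₑ ≤ ENNReal.ofReal (C / r ^ k) * ‖F z‖ₑ := by
      intro z
      by_cases hz : z ∈ Icc a b ×ˢ closedBall (0 : ℝ³) (R₀ + r)
      · rw [← ofReal_norm, ← ofReal_norm, ← ENNReal.ofReal_mul (by positivity), mul_comm]
        exact ENNReal.ofReal_le_ofReal (hbound r hr₁ z hz)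
      · rw [hzero r hr₁ z hz, enorm_zero]; exact zero_le
    have h1 : ∫⁻ z, ‖Φ r z‖ₑ ∂μ' ≤ ENNReal.ofReal (C / r ^ k) * I := by
      calc ∫⁻ z, ‖Φ r z‖ₑ ∂μ' ≤ ∫⁻ z, ENNReal.ofReal (C / r ^ k) * ‖F z‖ₑ ∂μ' := lintegral_mono hpt
        _ = ENNReal.ofReal (C / r ^ k) * I := by
            rw [hI, lintegral_const_mul' _ _ ENNReal.ofReal_ne_top]
    calc ‖∫ z, Φ r z‖ = ‖∫ z in Icc a b ×ˢ (univ : Set ℝ³), Φ r z‖ := by rw [hslab r hr₁]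
      _ ≤ (∫⁻ z, ENNReal.ofReal ‖Φ r z‖ ∂μ').toReal := norm_integral_le_lintegral_norm _
      _ = (∫⁻ z, ‖Φ r z‖ₑ ∂μ').toReal := by simp only [ofReal_norm]
      _ ≤ (ENNReal.ofReal (C / r ^ k) * I).toReal :=
          ENNReal.toReal_mono (ENNReal.mul_ne_top ENNReal.ofReal_ne_top hF1.ne) h1
      _ = C * I.toReal * (r ^ k)⁻¹ := by
          rw [ENNReal.toReal_mul, ENNReal.toReal_ofReal (by positivity)]; ring
  have hlim : Tendsto (fun r : ℝ => C * I.toReal * (r ^ k)⁻¹) atTop (𝓝 0) := by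
    have h := (tendsto_pow_atTop (α := ℝ) (n := k) (by omega)).inv_tendsto_atTop.const_mul (C * I.toReal)
    rw [mul_zero] at h
    exact h
  refine squeeze_zero_norm' ?_ hlim
  filter_upwards [eventually_ge_atTop (max r₁ 1)] with r hr
  exact key r hr

end Vanishing

/-! ### From `L^q` classes on time slabs: the unified vanishing lemma and local integrability -/

section Slabs

variable {G : Type*} [NormedAddCommGroup G]

/-- `∫ |f|^{q}` is finite for `f ∈ L^q`, `0 < q < ∞` (bookkeeping). [folklore] -/
theorem lintegral_enorm_rpow_toReal_lt_top_of_memLp {α : Type*} [MeasurableSpace α] {μ : Measure α}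
    {f : α → G} {q : ℝ≥0∞} (hq0 : q ≠ 0) (hqtop : q ≠ ⊤) (hf : MemLp f q μ) :
    ∫⁻ z, ‖f z‖ₑ ^ q.toReal ∂μ < ⊤ :=
  (eLpNorm_lt_top_iff_lintegral_rpow_enorm_lt_top hq0 hqtop).1 hf.2

/-- **Vanishing of box-supported remainders, `L^q` majorant on a time slab, `1 ≤ q < ∞`.** Let
`F ∈ L^q([a, b] × ℝ³)` and let `Φ_r`, `r ≥ r₁`, satisfy `|Φ_r| ≤ |F| · C/rᵏ` (`k ≥ 3`, `C ≥ 0`) on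
the box `[a, b] × B̄(0, R₀ + r)` and `Φ_r = 0` off it. Then `∫∫ Φ_r → 0` as `r → ∞` (the cases
`q = 1` and `q > 1` of the two previous lemmas; for `r ≥ 1`, `C/rᵏ ≤ C/r³`). [folklore] -/
theorem tendsto_integral_of_box_bound_memLp {F : ℝ × ℝ³ → G} {q : ℝ≥0∞} (hq1 : 1 ≤ q)
    (hqtop : q ≠ ⊤) {a b : ℝ} (hF : MemLp F q (volume.restrict (Icc a b ×ˢ (univ : Set ℝ³))))
    {Φ : ℝ → ℝ × ℝ³ → ℝ} {C R₀ r₁ : ℝ} {k : ℕ} (hk : 3 ≤ k) (hC : 0 ≤ C) (hR₀ : 0 ≤ R₀)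
    (hbound : ∀ r, r₁ ≤ r → ∀ z ∈ Icc a b ×ˢ closedBall (0 : ℝ³) (R₀ + r),
      ‖Φ r z‖ ≤ ‖F z‖ * (C / r ^ k))
    (hzero : ∀ r, r₁ ≤ r → ∀ z ∉ Icc a b ×ˢ closedBall (0 : ℝ³) (R₀ + r), Φ r z = 0) :
    Tendsto (fun r => ∫ z, Φ r z) atTop (𝓝 0) := by
  rcases hq1.eq_or_lt with h1 | h1
  · -- `q = 1`
    subst h1
    have hF1 : ∫⁻ z in Icc a b ×ˢ (univ : Set ℝ³), ‖F z‖ₑ < ⊤ := by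
      have h := lintegral_enorm_rpow_toReal_lt_top_of_memLp one_ne_zero ENNReal.one_ne_top hF
      simpa using h
    exact tendsto_integral_of_box_bound_one hF1 (by omega) hC hbound hzero
  · -- `q > 1`: real exponents
    have hq0 : q ≠ 0 := (zero_lt_one.trans h1).ne'
    have hqr : 1 < q.toReal := by
      have := (ENNReal.toReal_lt_toReal ENNReal.one_ne_top hqtop).2 h1
      simpa using this
    have hqq' : q.toReal.HolderConjugate (q.toReal / (q.toReal - 1)) := Real.HolderConjugate.conjExponent hqr
    refine tendsto_integral_of_box_bound hqq' hF.1.enorm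
      (lintegral_enorm_rpow_toReal_lt_top_of_memLp hq0 hqtop hF) hC hR₀ (r₁ := max r₁ 1)
      (fun r hr z hz => ?_) (fun r hr z hz => hzero r ((le_max_left _ _).trans hr) z hz)
    have hr1 : 1 ≤ r := (le_max_right _ _).trans hr
    refine (hbound r ((le_max_left _ _).trans hr) z hz).trans
      (mul_le_mul_of_nonneg_left ?_ (norm_nonneg _))
    exact div_le_div_of_nonneg_left hC (by positivity) (pow_le_pow_right₀ hr1 hk)

/-- A compact subset of `ℝ × ℝ³` lies in a time slab `[a, b] × ℝ³`. [folklore] -/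
theorem exists_subset_Icc_prod_univ_of_isCompact {K : Set (ℝ × ℝ³)} (hK : IsCompact K) :
    ∃ a b : ℝ, K ⊆ Icc a b ×ˢ (univ : Set ℝ³) := by
  have h1 : IsCompact (Prod.fst '' K) := hK.image continuous_fst
  obtain ⟨b, hb⟩ := h1.isBounded.bddAbove
  obtain ⟨a, ha⟩ := h1.isBounded.bddBelow
  exact ⟨a, b, fun z hz => ⟨⟨ha ⟨z, hz, rfl⟩, hb ⟨z, hz, rfl⟩⟩, mem_univ _⟩⟩

/-- **Local integrability from the slab classes**: if `F ∈ L^q([a, b] × ℝ³)` for all `a, b`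
with `2 ≤ q`, then `F` and `|F|²` are locally integrable on `ℝ × ℝ³` (on a compact set, which
lies in a slab and has finite measure, `L^q ⊂ L² ⊂ L¹`). [folklore] -/
theorem locallyIntegrable_and_sq_of_memLp_slab {F : ℝ × ℝ³ → G} {q : ℝ≥0∞} (hq : 2 ≤ q)
    (hF : ∀ a b : ℝ, MemLp F q (volume.restrict (Icc a b ×ˢ (univ : Set ℝ³)))) :
    LocallyIntegrable F volume ∧ LocallyIntegrable (fun z => ‖F z‖ ^ 2) volume := by
  have hK2 : ∀ K : Set (ℝ × ℝ³), IsCompact K → MemLp F 2 (volume.restrict K) := by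
    intro K hK
    obtain ⟨a, b, hKab⟩ := exists_subset_Icc_prod_univ_of_isCompact hK
    haveI : IsFiniteMeasure (volume.restrict K) := isFiniteMeasure_restrict.2 hK.measure_lt_top.ne
    have h1 : MemLp F q (volume.restrict K) := by
      have h := (hF a b).restrict K
      rwa [Measure.restrict_restrict hK.measurableSet, inter_eq_left.2 hKab] at h
    exact h1.mono_exponent hq
  refine ⟨locallyIntegrable_iff.2 fun K hK => ?_, locallyIntegrable_iff.2 fun K hK => ?_⟩
  · haveI : IsFiniteMeasure (volume.restrict K) := isFiniteMeasure_restrict.2 hK.measure_lt_top.ne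
    exact (hK2 K hK).integrable one_le_two
  · exact (memLp_two_iff_integrable_sq_norm (hK2 K hK).1).1 (hK2 K hK)

/-- **Local integrability from the slab classes, `q ≥ 1`**: if `F ∈ L^q([a, b] × ℝ³)` for all
`a, b` with `1 ≤ q`, then `F` is locally integrable on `ℝ × ℝ³`. [folklore] -/
theorem locallyIntegrable_of_memLp_slab {F : ℝ × ℝ³ → G} {q : ℝ≥0∞} (hq : 1 ≤ q)
    (hF : ∀ a b : ℝ, MemLp F q (volume.restrict (Icc a b ×ˢ (univ : Set ℝ³)))) :
    LocallyIntegrable F volume := by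
  refine locallyIntegrable_iff.2 fun K hK => ?_
  obtain ⟨a, b, hKab⟩ := exists_subset_Icc_prod_univ_of_isCompact hK
  haveI : IsFiniteMeasure (volume.restrict K) := isFiniteMeasure_restrict.2 hK.measure_lt_top.ne
  have h1 : MemLp F q (volume.restrict K) := by
    have h := (hF a b).restrict K
    rwa [Measure.restrict_restrict hK.measurableSet, inter_eq_left.2 hKab] at h
  exact h1.integrable hq

/-- The restriction of Lebesgue measure to a time slab is the product of the restricted time
measure with Lebesgue measure in space. [folklore] -/
theorem volume_restrict_Icc_prod_univ (a b : ℝ) :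
    (volume : Measure (ℝ × ℝ³)).restrict (Icc a b ×ˢ (univ : Set ℝ³)) =
      ((volume : Measure ℝ).restrict (Icc a b)).prod (volume : Measure ℝ³) := by
  rw [show (volume : Measure (ℝ × ℝ³)) = (volume : Measure ℝ).prod (volume : Measure ℝ³) from rfl,
    ← Measure.restrict_univ (μ := (volume : Measure ℝ³)), Measure.prod_restrict,
    Measure.restrict_univ]

/-- **The slab classes from uniform slice bounds**: a jointly measurable field with
`∫ |F(s)|^q ≤ C < ∞` for every `s` (`0 < q < ∞`) belongs to `L^q([a, b] × ℝ³)` for all `a, b`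
(Tonelli: `∫∫_{[a,b]×ℝ³} |F|^q ≤ (b - a) C`). [folklore] -/
theorem memLp_slab_of_forall_lintegral_le {F : ℝ → ℝ³ → G}
    (hFm : AEStronglyMeasurable (uncurry F) volume) {q : ℝ≥0∞} (hq0 : q ≠ 0) (hqtop : q ≠ ⊤)
    {C : ℝ≥0∞} (hC : C ≠ ⊤) (hF : ∀ s, ∫⁻ y, ‖F s y‖ₑ ^ q.toReal ≤ C) (a b : ℝ) :
    MemLp (uncurry F) q (volume.restrict (Icc a b ×ˢ (univ : Set ℝ³))) := by
  refine ⟨hFm.restrict, (eLpNorm_lt_top_iff_lintegral_rpow_enorm_lt_top hq0 hqtop).2 ?_⟩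
  rw [volume_restrict_Icc_prod_univ]
  have hm : AEMeasurable (fun z : ℝ × ℝ³ => ‖uncurry F z‖ₑ ^ q.toReal)
      (((volume : Measure ℝ).restrict (Icc a b)).prod (volume : Measure ℝ³)) := by
    have h := (hFm.enorm.pow_const q.toReal)
    rw [show (volume : Measure (ℝ × ℝ³)) = (volume : Measure ℝ).prod (volume : Measure ℝ³) from rfl] at h
    exact h.mono_measure (Measure.prod_mono Measure.restrict_le_self le_rfl)
  rw [lintegral_prod _ hm]
  calc ∫⁻ s in Icc a b, ∫⁻ y, ‖uncurry F (s, y)‖ₑ ^ q.toReal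
      ≤ ∫⁻ _ in Icc a b, C := lintegral_mono fun s => hF s
    _ = C * volume (Icc a b) := by rw [lintegral_const, Measure.restrict_apply_univ]
    _ < ⊤ := ENNReal.mul_lt_top hC.lt_top (by rw [Real.volume_Icc]; exact ENNReal.ofReal_lt_top)

/-- The same from uniform bounds on the slice `L^q` norms, `‖F(s)‖_{L^q} ≤ C < ∞`. [folklore] -/
theorem memLp_slab_of_forall_eLpNorm_le {F : ℝ → ℝ³ → G}
    (hFm : AEStronglyMeasurable (uncurry F) volume) {q : ℝ≥0∞} (hq0 : q ≠ 0) (hqtop : q ≠ ⊤)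
    {C : ℝ≥0∞} (hC : C ≠ ⊤) (hF : ∀ s, eLpNorm (F s) q volume ≤ C) (a b : ℝ) :
    MemLp (uncurry F) q (volume.restrict (Icc a b ×ˢ (univ : Set ℝ³))) := by
  have hq : 0 < q.toReal := ENNReal.toReal_pos hq0 hqtop
  refine memLp_slab_of_forall_lintegral_le hFm hq0 hqtop (C := C ^ q.toReal)
    (ENNReal.rpow_ne_top_of_nonneg hq.le hC) (fun s => ?_) a b
  have h := hF s
  rw [eLpNorm_eq_lintegral_rpow_enorm_toReal hq0 hqtop] at h
  have h' := ENNReal.rpow_le_rpow h hq.le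
  rwa [← ENNReal.rpow_mul, one_div_mul_cancel hq.ne', ENNReal.rpow_one] at h'

/-- `|f|² ∈ L^{q/2}` for `f ∈ L^q`. [folklore] -/
theorem memLp_norm_sq_of_memLp {α : Type*} [MeasurableSpace α] {μ : Measure α}
    {f : α → G} {q : ℝ≥0∞} (hf : MemLp f q μ) :
    MemLp (fun z => ‖f z‖ ^ 2) (q / 2) μ := by
  have h := hf.norm_rpow_div (2 : ℝ≥0∞)
  simpa [Real.rpow_two] using h

end Slabs

/-! ### Slice calculus: the Hessian pairing and the field `φ + y·∇φ` -/

section Calculus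

/-- **`⟪v, D(∇θ)(x) w⟫ = D²θ(x)(w, v)`** for `θ ∈ C²` (the bilinear form of the tree's
`inner_fderiv_gradient_apply`: chain rule through the Riesz isometry). [folklore] -/
theorem inner_fderiv_gradient_apply₂ {θ : ℝ³ → ℝ} (hθ : ContDiff ℝ 2 θ) (x v w : ℝ³) :
    ⟪v, fderiv ℝ (gradient θ) x w⟫ = fderiv ℝ (fderiv ℝ θ) x w v := by
  set L : (ℝ³ →L[ℝ] ℝ) →L[ℝ] ℝ³ :=
    (InnerProductSpace.toDual ℝ ℝ³).symm.toContinuousLinearEquiv.toContinuousLinearMap with hL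
  have hLapp : ∀ w : ℝ³ →L[ℝ] ℝ, L w = (InnerProductSpace.toDual ℝ ℝ³).symm w := fun w => rfl
  have hd : DifferentiableAt ℝ (fderiv ℝ θ) x :=
    ((hθ.fderiv_right (m := 1) le_rfl).differentiable one_ne_zero) x
  have h1 : gradient θ = fun y => L (fderiv ℝ θ y) := rfl
  have h2 : HasFDerivAt (fun y => L (fderiv ℝ θ y)) (L.comp (fderiv ℝ (fderiv ℝ θ) x)) x :=
    L.hasFDerivAt.comp x hd.hasFDerivAt
  rw [h1, h2.fderiv, ContinuousLinearMap.comp_apply, hLapp, real_inner_comm,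
    InnerProductSpace.toDual_symm_apply]

/-- **`D(y ↦ Dφ(y) y)(x) = Dφ(x) + D²φ(x)(·, x)`** for `φ ∈ C²` (Leibniz rule for the
evaluation `(Dφ(y), y) ↦ Dφ(y) y`). [folklore] -/
theorem hasFDerivAt_fderiv_apply_self {φ : ℝ³ → ℝ} (hφ : ContDiff ℝ 2 φ) (x : ℝ³) :
    HasFDerivAt (fun y => fderiv ℝ φ y y)
      ((fderiv ℝ φ x).comp (ContinuousLinearMap.id ℝ ℝ³) + (fderiv ℝ (fderiv ℝ φ) x).flip x) x := by
  have hd : DifferentiableAt ℝ (fderiv ℝ φ) x :=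
    ((hφ.fderiv_right (m := 1) le_rfl).differentiable one_ne_zero) x
  exact hd.hasFDerivAt.clm_apply (hasFDerivAt_id x)

/-- **`⟪v, 2∇φ(x) + D(∇φ)(x) x⟫ = ⟪v, ∇(φ + y·∇φ)(x)⟫`** for `φ ∈ C²`: the zeroth-order and
dilation terms `−u − y·∇u` of the Leray operator, tested with a gradient field `∇φ`, pair `u`
with the gradient of the compactly supported function `φ + y·∇φ` (`∂ᵢ(yⱼ∂ⱼφ) = ∂ᵢφ + yⱼ∂ᵢ∂ⱼφ`
and Schwarz). [folklore] -/
theorem inner_two_smul_gradient_add_fderiv_gradient_self {φ : ℝ³ → ℝ} (hφ : ContDiff ℝ 2 φ)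
    (x v : ℝ³) :
    ⟪v, (2 : ℝ) • gradient φ x + fderiv ℝ (fun y => gradient φ y) x x⟫ =
      ⟪v, gradient (fun y => φ y + fderiv ℝ φ y y) x⟫ := by
  have hsymm : fderiv ℝ (fderiv ℝ φ) x v x = fderiv ℝ (fderiv ℝ φ) x x v :=
    (hφ.contDiffAt.isSymmSndFDerivAt (by simp)) v x
  have hΘ : HasFDerivAt (fun y => φ y + fderiv ℝ φ y y)
      (fderiv ℝ φ x + ((fderiv ℝ φ x).comp (ContinuousLinearMap.id ℝ ℝ³) +
        (fderiv ℝ (fderiv ℝ φ) x).flip x)) x :=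
    ((hφ.differentiable (by simp)) x).hasFDerivAt.add (hasFDerivAt_fderiv_apply_self hφ x)
  have key : ∀ f : ℝ³ → ℝ, ⟪v, gradient f x⟫ = fderiv ℝ f x v := fun f => by
    rw [gradient, real_inner_comm, InnerProductSpace.toDual_symm_apply]
  rw [key, hΘ.fderiv, inner_add_right, inner_smul_right, key,
    show (fun y => gradient φ y) = gradient φ from rfl, inner_fderiv_gradient_apply₂ hφ x v x]
  simp only [add_apply, ContinuousLinearMap.comp_apply,
    ContinuousLinearMap.id_apply, ContinuousLinearMap.flip_apply]
  rw [hsymm]; ring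

/-- For a space–time test function `φ` on `ℝ × ℝ³`, `(t, y) ↦ φ(t, y) + Dφ(t, ·)(y) y`
(`= φ + y·∇φ`) is a space–time test function. [folklore] -/
theorem IsSpaceTimeTestOn.add_fderiv_apply_self {φ : ℝ → ℝ³ → ℝ}
    (hφ : IsSpaceTimeTestOn (⊤ : Opens (ℝ × ℝ³)) φ) :
    IsSpaceTimeTestOn (⊤ : Opens (ℝ × ℝ³)) (fun t y => φ t y + fderiv ℝ (φ t) y y) := by
  have hD := hφ.fderiv_top
  have h2 : IsSpaceTimeTestOn (⊤ : Opens (ℝ × ℝ³)) (fun t y => fderiv ℝ (φ t) y y) := by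
    refine ⟨?_, ?_, by simp⟩
    · have e : uncurry (fun t y => fderiv ℝ (φ t) y y) =
          fun z : ℝ × ℝ³ => (uncurry (fun t y => fderiv ℝ (φ t) y) z) z.2 := by
        funext z; rfl
      rw [e]
      exact isBoundedBilinearMap_apply.contDiff.comp (hD.contDiff.prodMk contDiff_snd)
    · refine HasCompactSupport.intro hφ.hasCompactSupport fun z hz => ?_
      obtain ⟨t, y⟩ := z
      simp [IsSpaceTimeTestOn.fderiv_slice_eq_zero_of_notMem hz]
  exact hφ.add h2

end Calculus

/-! ### Local integrability of the pairings -/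

section Pairings

variable {G : Type*} [NormedAddCommGroup G]

/-- `|F + G|²` is locally integrable when `|F|²` and `|G|²` are (and `F`, `G` are measurable).
[folklore] -/
theorem locallyIntegrable_norm_add_sq {F₁ F₂ : ℝ × ℝ³ → G} (h₁ : AEStronglyMeasurable F₁ volume)
    (h₂ : AEStronglyMeasurable F₂ volume) (h₁s : LocallyIntegrable (fun z => ‖F₁ z‖ ^ 2) volume)
    (h₂s : LocallyIntegrable (fun z => ‖F₂ z‖ ^ 2) volume) :
    LocallyIntegrable (fun z => ‖F₁ z + F₂ z‖ ^ 2) volume := by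
  refine locallyIntegrable_iff.2 fun K hK => ?_
  refine Integrable.mono' (((h₁s.integrableOn_isCompact hK).add (h₂s.integrableOn_isCompact hK)).const_mul 2)
    ((h₁.add h₂).norm.pow 2).restrict (Eventually.of_forall fun z => ?_)
  rw [Real.norm_eq_abs, abs_of_nonneg (by positivity)]
  show ‖F₁ z + F₂ z‖ ^ 2 ≤ 2 * (‖F₁ z‖ ^ 2 + ‖F₂ z‖ ^ 2)
  nlinarith [norm_add_le (F₁ z) (F₂ z), sq_nonneg (‖F₁ z‖ - ‖F₂ z‖), norm_nonneg (F₁ z + F₂ z),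
    norm_nonneg (F₁ z), norm_nonneg (F₂ z)]

/-- **Integrability of a bilinear pairing `⟪F₁, D(z) F₂⟫`** on `ℝ × ℝ³` for `F₁, F₂` with locally
integrable squares, against a continuous operator field `D` supported in a compact set
(`|⟪F₁, DF₂⟫| ≤ sup‖D‖ (|F₁|² + |F₂|²)/2`). [folklore] -/
theorem integrable_inner_clm_apply {F₁ F₂ : ℝ × ℝ³ → ℝ³} (h₁ : LocallyIntegrable F₁ volume)
    (h₂ : LocallyIntegrable F₂ volume) (h₁s : LocallyIntegrable (fun z => ‖F₁ z‖ ^ 2) volume)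
    (h₂s : LocallyIntegrable (fun z => ‖F₂ z‖ ^ 2) volume)
    {D : ℝ × ℝ³ → ℝ³ →L[ℝ] ℝ³} (hD : Continuous D) {K : Set (ℝ × ℝ³)} (hK : IsCompact K)
    (hDK : ∀ z ∉ K, D z = 0) :
    Integrable (fun z : ℝ × ℝ³ => ⟪F₁ z, D z (F₂ z)⟫) (volume : Measure (ℝ × ℝ³)) := by
  have h₁K : IntegrableOn F₁ K volume := h₁.integrableOn_isCompact hK
  have h₂K : IntegrableOn F₂ K volume := h₂.integrableOn_isCompact hK
  have hDc : HasCompactSupport D := HasCompactSupport.intro hK hDK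
  obtain ⟨C, hC⟩ := hD.bounded_above_of_compact_support hDc
  have hC0 : 0 ≤ C := (norm_nonneg _).trans (hC 0)
  have hsupp : support (fun z : ℝ × ℝ³ => ⟪F₁ z, D z (F₂ z)⟫) ⊆ K := by
    intro z hz
    by_contra hzK
    exact hz (by simp [hDK z hzK])
  refine (integrableOn_iff_integrable_of_support_subset hsupp).1 ?_
  have hm : AEStronglyMeasurable (fun z : ℝ × ℝ³ => D z (F₂ z)) (volume.restrict K) :=
    isBoundedBilinearMap_apply.continuous.comp_aestronglyMeasurable
      (hD.aestronglyMeasurable.prodMk h₂K.aestronglyMeasurable)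
  refine Integrable.mono'
    ((((h₁s.integrableOn_isCompact hK).add (h₂s.integrableOn_isCompact hK))).const_mul (C / 2))
    (h₁K.aestronglyMeasurable.inner hm) ?_
  filter_upwards with z
  have h2ab : 2 * ‖F₁ z‖ * ‖F₂ z‖ ≤ ‖F₁ z‖ ^ 2 + ‖F₂ z‖ ^ 2 := two_mul_le_add_sq _ _
  calc ‖⟪F₁ z, D z (F₂ z)⟫‖ ≤ ‖F₁ z‖ * ‖D z (F₂ z)‖ := norm_inner_le_norm _ _
    _ ≤ ‖F₁ z‖ * (C * ‖F₂ z‖) := by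
        gcongr
        exact (ContinuousLinearMap.le_opNorm _ _).trans
          (mul_le_mul_of_nonneg_right (hC z) (norm_nonneg _))
    _ = C / 2 * (2 * ‖F₁ z‖ * ‖F₂ z‖) := by ring
    _ ≤ C / 2 * (‖F₁ z‖ ^ 2 + ‖F₂ z‖ ^ 2) := mul_le_mul_of_nonneg_left h2ab (by positivity)

end Pairings

namespace BradshawTsai2017

/-! ### The very weak integrand of the mollified perturbed Leray system -/

section Integrand

variable {U W V : ℝ → ℝ³ → ℝ³} {p : ℝ → ℝ³ → ℝ}

/-- **The very weak (pressure-free) integrand of the mollified perturbed Leray system** tested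
with a vector field `χ`: for the unknown `U`, the profile `W` and the mollified field `V`
(`= η_ε * U` in [BT1]), with `u = U + W` and drift `b = W + V`,
`⟪u, ∂ₛχ⟫ + ⟪u, Δχ⟫ − ⟪u, 2χ + (y·∇)χ⟫ + ⟪U, (b·∇)χ⟫ + ⟪W, (u·∇)χ⟫` — the integrand of the
`distributional` clause of `IsMollifiedPeriodicWeakSolution` without its pressure term
`p div χ` ([BT1] §2: the system `Lu + b·∇U + u·∇W + ∇p = 0`, `L = ∂ₛ − Δ − 1 − y·∇`, with every
derivative on the test field). [cite: BradshawTsai2017AHP, §2 (mollified perturbed Leray system)] -/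
def lerayVeryWeakIntegrand (U W V : ℝ → ℝ³ → ℝ³) (χ : ℝ → ℝ³ → ℝ³) (z : ℝ × ℝ³) : ℝ :=
  ⟪U z.1 z.2 + W z.1 z.2, timeDeriv χ z.1 z.2⟫ + ⟪U z.1 z.2 + W z.1 z.2, Δ (χ z.1) z.2⟫ -
    ⟪U z.1 z.2 + W z.1 z.2, (2 : ℝ) • χ z.1 z.2 + fderiv ℝ (χ z.1) z.2 z.2⟫ +
    ⟪U z.1 z.2, convect (W z.1 + V z.1) (χ z.1) z.2⟫ +
    ⟪W z.1 z.2, convect (U z.1 + W z.1) (χ z.1) z.2⟫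

/-- Unfolding `lerayVeryWeakIntegrand`. [folklore] -/
theorem lerayVeryWeakIntegrand_apply (U W V : ℝ → ℝ³ → ℝ³) (χ : ℝ → ℝ³ → ℝ³) (z : ℝ × ℝ³) :
    lerayVeryWeakIntegrand U W V χ z =
      ⟪U z.1 z.2 + W z.1 z.2, timeDeriv χ z.1 z.2⟫ + ⟪U z.1 z.2 + W z.1 z.2, Δ (χ z.1) z.2⟫ -
        ⟪U z.1 z.2 + W z.1 z.2, (2 : ℝ) • χ z.1 z.2 + fderiv ℝ (χ z.1) z.2 z.2⟫ +
        ⟪U z.1 z.2, convect (W z.1 + V z.1) (χ z.1) z.2⟫ +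
        ⟪W z.1 z.2, convect (U z.1 + W z.1) (χ z.1) z.2⟫ :=
  rfl

/-- Linearity of the very weak integrand in the test field (differences of test fields).
[folklore] -/
theorem lerayVeryWeakIntegrand_sub {Q : Opens (ℝ × ℝ³)} {χ₁ χ₂ : ℝ → ℝ³ → ℝ³}
    (h₁ : IsSpaceTimeTestOn Q χ₁) (h₂ : IsSpaceTimeTestOn Q χ₂) (z : ℝ × ℝ³) :
    lerayVeryWeakIntegrand U W V (fun t x => χ₁ t x - χ₂ t x) z =
      lerayVeryWeakIntegrand U W V χ₁ z - lerayVeryWeakIntegrand U W V χ₂ z := by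
  simp only [lerayVeryWeakIntegrand_apply, convect]
  have hd₁ : DifferentiableAt ℝ (χ₁ z.1) z.2 := ((h₁.contDiff_slice z.1).differentiable (by simp)) z.2
  have hd₂ : DifferentiableAt ℝ (χ₂ z.1) z.2 := ((h₂.contDiff_slice z.1).differentiable (by simp)) z.2
  have hc₁ : ContDiffAt ℝ 2 (χ₁ z.1) z.2 := ((h₁.contDiff_slice z.1).of_le (by norm_cast)).contDiffAt
  have hc₂ : ContDiffAt ℝ 2 (χ₂ z.1) z.2 := ((h₂.contDiff_slice z.1).of_le (by norm_cast)).contDiffAt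
  rw [h₁.timeDeriv_sub h₂, show (fun x => χ₁ z.1 x - χ₂ z.1 x) = χ₁ z.1 - χ₂ z.1 from rfl,
    fderiv_sub hd₁ hd₂, hc₁.laplacian_sub hc₂]
  simp only [inner_sub_right, inner_add_right, smul_sub, FunLike.coe_sub, Pi.sub_apply]
  ring

/-- **Integrability of the five very weak terms** on `ℝ × ℝ³` for a test field `χ`, when `U`, `W`,
`V` and their squares are locally integrable. [folklore] -/
theorem integrable_lerayVeryWeak_terms (hU1 : LocallyIntegrable (uncurry U) volume)
    (hW1 : LocallyIntegrable (uncurry W) volume) (hV1 : LocallyIntegrable (uncurry V) volume)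
    (hU2 : LocallyIntegrable (fun z => ‖uncurry U z‖ ^ 2) volume)
    (hW2 : LocallyIntegrable (fun z => ‖uncurry W z‖ ^ 2) volume)
    (hV2 : LocallyIntegrable (fun z => ‖uncurry V z‖ ^ 2) volume)
    {χ : ℝ → ℝ³ → ℝ³} (hχ : IsSpaceTimeTestOn (⊤ : Opens (ℝ × ℝ³)) χ) :
    Integrable (fun z : ℝ × ℝ³ => ⟪U z.1 z.2 + W z.1 z.2, timeDeriv χ z.1 z.2⟫)
        (volume : Measure (ℝ × ℝ³)) ∧
      Integrable (fun z : ℝ × ℝ³ => ⟪U z.1 z.2 + W z.1 z.2, Δ (χ z.1) z.2⟫)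
        (volume : Measure (ℝ × ℝ³)) ∧
      Integrable (fun z : ℝ × ℝ³ =>
        ⟪U z.1 z.2 + W z.1 z.2, (2 : ℝ) • χ z.1 z.2 + fderiv ℝ (χ z.1) z.2 z.2⟫)
        (volume : Measure (ℝ × ℝ³)) ∧
      Integrable (fun z : ℝ × ℝ³ => ⟪U z.1 z.2, convect (W z.1 + V z.1) (χ z.1) z.2⟫)
        (volume : Measure (ℝ × ℝ³)) ∧
      Integrable (fun z : ℝ × ℝ³ => ⟪W z.1 z.2, convect (U z.1 + W z.1) (χ z.1) z.2⟫)
        (volume : Measure (ℝ × ℝ³)) := by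
  have hK : IsCompact (tsupport (uncurry χ)) := hχ.hasCompactSupport
  have hu1 : LocallyIntegrableOn (uncurry fun s y => U s y + W s y)
      ((⊤ : Opens (ℝ × ℝ³)) : Set (ℝ × ℝ³)) volume := (hU1.add hW1).locallyIntegrableOn _
  have hKQ : tsupport (uncurry χ) ⊆ ((⊤ : Opens (ℝ × ℝ³)) : Set (ℝ × ℝ³)) := fun _ _ => trivial
  have hD : Continuous fun z : ℝ × ℝ³ => fderiv ℝ (χ z.1) z.2 := hχ.fderiv_top.contDiff.continuous
  have hD0 : ∀ z ∉ tsupport (uncurry χ), fderiv ℝ (χ z.1) z.2 = 0 := fun z hz =>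
    IsSpaceTimeTestOn.fderiv_slice_eq_zero_of_notMem hz
  refine ⟨?_, ?_, ?_, ?_, ?_⟩
  · have h := hχ.timeDeriv_top
    exact integrable_inner_of_locallyIntegrableOn hu1 (w := uncurry (timeDeriv χ))
      h.contDiff.continuous hK hKQ fun z hz =>
        IsSpaceTimeTestOn.timeDeriv_eq_zero_of_notMem (ψ := χ) (t := z.1) (x := z.2) hz
  · have h := hχ.laplacian_top
    exact integrable_inner_of_locallyIntegrableOn hu1 (w := uncurry fun t => Δ (χ t))
      h.contDiff.continuous hK hKQ fun z hz => laplacian_slice_eq_zero_of_notMem_tsupport hz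
  · refine integrable_inner_of_locallyIntegrableOn hu1
      (w := fun z : ℝ × ℝ³ => (2 : ℝ) • χ z.1 z.2 + fderiv ℝ (χ z.1) z.2 z.2) ?_ hK hKQ fun z hz => ?_
    · exact (hχ.contDiff.continuous.const_smul (2 : ℝ)).add (hD.clm_apply continuous_snd)
    · have h0 : χ z.1 z.2 = 0 := (image_eq_zero_of_notMem_tsupport hz : uncurry χ z = 0)
      simp [h0, hD0 z hz]
  · have hWV2 : LocallyIntegrable (fun z => ‖uncurry W z + uncurry V z‖ ^ 2) volume :=
      locallyIntegrable_norm_add_sq hW1.aestronglyMeasurable hV1.aestronglyMeasurable hW2 hV2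
    exact integrable_inner_clm_apply (F₁ := uncurry U) (F₂ := fun z => uncurry W z + uncurry V z)
      hU1 (hW1.add hV1) hU2 hWV2 hD hK hD0
  · have hUW2 : LocallyIntegrable (fun z => ‖uncurry U z + uncurry W z‖ ^ 2) volume :=
      locallyIntegrable_norm_add_sq hU1.aestronglyMeasurable hW1.aestronglyMeasurable hU2 hW2
    exact integrable_inner_clm_apply (F₁ := uncurry W) (F₂ := fun z => uncurry U z + uncurry W z)
      hW1 (hU1.add hW1) hW2 hUW2 hD hK hD0

/-- The very weak integrand of a test field is integrable. [folklore] -/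
theorem integrable_lerayVeryWeakIntegrand (hU1 : LocallyIntegrable (uncurry U) volume)
    (hW1 : LocallyIntegrable (uncurry W) volume) (hV1 : LocallyIntegrable (uncurry V) volume)
    (hU2 : LocallyIntegrable (fun z => ‖uncurry U z‖ ^ 2) volume)
    (hW2 : LocallyIntegrable (fun z => ‖uncurry W z‖ ^ 2) volume)
    (hV2 : LocallyIntegrable (fun z => ‖uncurry V z‖ ^ 2) volume)
    {χ : ℝ → ℝ³ → ℝ³} (hχ : IsSpaceTimeTestOn (⊤ : Opens (ℝ × ℝ³)) χ) :
    Integrable (lerayVeryWeakIntegrand U W V χ) (volume : Measure (ℝ × ℝ³)) := by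
  obtain ⟨h1, h2, h3, h4, h5⟩ := integrable_lerayVeryWeak_terms hU1 hW1 hV1 hU2 hW2 hV2 hχ
  exact (((h1.add h2).sub h3).add h4).add h5

/-- **The very weak integrand against a gradient test field** `∇θ`, `θ ∈ C_c^∞(ℝ × ℝ³)`: if
`u = U + W` is weakly divergence free on `ℝ × ℝ³` and `p` solves the weak pressure Poisson equation
`∫∫ p Δθ = -∫∫ (D²θ(b, U) + D²θ(u, W))`, `b = W + V`, then `∫∫ W(∇θ) = -∫∫ p Δθ`: the terms
`⟪u, ∂ₛ∇θ⟫ = ⟪u, ∇∂ₛθ⟫`, `⟪u, Δ∇θ⟫ = ⟪u, ∇Δθ⟫` and `⟪u, 2∇θ + (y·∇)∇θ⟫ = ⟪u, ∇(θ + y·∇θ)⟫`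
pair to zero with `u`, and the drift terms are the Hessian pairings
`⟪U, (b·∇)∇θ⟫ + ⟪W, (u·∇)∇θ⟫ = D²θ(b, U) + D²θ(u, W)`. [cite: BradshawTsai2017AHP, proof of Thm 2.4 ("∇(p_ε − p̃_ε) = 0")] -/
theorem integral_lerayVeryWeakIntegrand_gradient (hU1 : LocallyIntegrable (uncurry U) volume)
    (hW1 : LocallyIntegrable (uncurry W) volume) (hV1 : LocallyIntegrable (uncurry V) volume)
    (hU2 : LocallyIntegrable (fun z => ‖uncurry U z‖ ^ 2) volume)
    (hW2 : LocallyIntegrable (fun z => ‖uncurry W z‖ ^ 2) volume)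
    (hV2 : LocallyIntegrable (fun z => ‖uncurry V z‖ ^ 2) volume)
    (hdiv : ∀ θ : ℝ → ℝ³ → ℝ, IsSpaceTimeTestOn (⊤ : Opens (ℝ × ℝ³)) θ →
      ∫ z : ℝ × ℝ³, ⟪U z.1 z.2 + W z.1 z.2, gradient (θ z.1) z.2⟫ = 0)
    (hpois : ∀ θ : ℝ → ℝ³ → ℝ, IsSpaceTimeTestOn (⊤ : Opens (ℝ × ℝ³)) θ →
      ∫ z : ℝ × ℝ³, p z.1 z.2 * Δ (θ z.1) z.2 =
        -∫ z : ℝ × ℝ³, (fderiv ℝ (fderiv ℝ (θ z.1)) z.2 (W z.1 z.2 + V z.1 z.2) (U z.1 z.2) +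
          fderiv ℝ (fderiv ℝ (θ z.1)) z.2 (U z.1 z.2 + W z.1 z.2) (W z.1 z.2)))
    {θ : ℝ → ℝ³ → ℝ} (hθ : IsSpaceTimeTestOn (⊤ : Opens (ℝ × ℝ³)) θ) :
    ∫ z, lerayVeryWeakIntegrand U W V (fun t x => gradient (θ t) x) z =
      -∫ z : ℝ × ℝ³, p z.1 z.2 * Δ (θ z.1) z.2 := by
  have h1 := hθ.timeDeriv_top
  have h2 := hθ.laplacian_top
  have h3 := hθ.add_fderiv_apply_self
  have hθ2 : ∀ t, ContDiff ℝ 2 (θ t) := fun t => (hθ.contDiff_slice t).of_le (by norm_cast)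
  have hθ3 : ∀ t, ContDiff ℝ 3 (θ t) := fun t => (hθ.contDiff_slice t).of_le (by norm_cast)
  -- pointwise form of the integrand
  have hpt : ∀ z : ℝ × ℝ³, lerayVeryWeakIntegrand U W V (fun t x => gradient (θ t) x) z =
      (fderiv ℝ (fderiv ℝ (θ z.1)) z.2 (W z.1 z.2 + V z.1 z.2) (U z.1 z.2) +
          fderiv ℝ (fderiv ℝ (θ z.1)) z.2 (U z.1 z.2 + W z.1 z.2) (W z.1 z.2)) +
        (⟪U z.1 z.2 + W z.1 z.2, gradient (timeDeriv θ z.1) z.2⟫ +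
          ⟪U z.1 z.2 + W z.1 z.2, gradient (fun y => Δ (θ z.1) y) z.2⟫ -
          ⟪U z.1 z.2 + W z.1 z.2, gradient (fun y => θ z.1 y + fderiv ℝ (θ z.1) y y) z.2⟫) := by
    rintro ⟨t, x⟩
    rw [lerayVeryWeakIntegrand_apply]
    have e1 : timeDeriv (fun s y => gradient (θ s) y) t x = gradient (timeDeriv θ t) x :=
      hθ.timeDeriv_gradient t x
    have e3 : Δ (fun y => gradient (θ t) y) x = gradient (fun y => Δ (θ t) y) x :=
      laplacian_gradient (hθ3 t) x
    have e4 : convect (W t + V t) (fun y => gradient (θ t) y) x =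
        fderiv ℝ (gradient (θ t)) x (W t x + V t x) := rfl
    have e5 : convect (U t + W t) (fun y => gradient (θ t) y) x =
        fderiv ℝ (gradient (θ t)) x (U t x + W t x) := rfl
    simp only
    rw [e1, e3, e4, e5, inner_fderiv_gradient_apply₂ (hθ2 t), inner_fderiv_gradient_apply₂ (hθ2 t),
      inner_two_smul_gradient_add_fderiv_gradient_self (hθ2 t)]
    ring
  simp_rw [hpt]
  obtain ⟨c1, -, z1⟩ := h1.continuous_gradient_field
  obtain ⟨c2, -, z2⟩ := h2.continuous_gradient_field
  obtain ⟨c3, -, z3⟩ := h3.continuous_gradient_field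
  have hu1 : LocallyIntegrableOn (uncurry fun s y => U s y + W s y)
      ((⊤ : Opens (ℝ × ℝ³)) : Set (ℝ × ℝ³)) volume := (hU1.add hW1).locallyIntegrableOn _
  have hKQ : ∀ K : Set (ℝ × ℝ³), K ⊆ ((⊤ : Opens (ℝ × ℝ³)) : Set (ℝ × ℝ³)) := fun _ _ _ => trivial
  have I1 : Integrable (fun z : ℝ × ℝ³ => ⟪U z.1 z.2 + W z.1 z.2, gradient (timeDeriv θ z.1) z.2⟫)
      (volume : Measure (ℝ × ℝ³)) :=
    integrable_inner_of_locallyIntegrableOn hu1 c1 h1.hasCompactSupport (hKQ _) z1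
  have I2 : Integrable (fun z : ℝ × ℝ³ =>
      ⟪U z.1 z.2 + W z.1 z.2, gradient (fun y => Δ (θ z.1) y) z.2⟫) (volume : Measure (ℝ × ℝ³)) :=
    integrable_inner_of_locallyIntegrableOn hu1 c2 h2.hasCompactSupport (hKQ _) z2
  have I3 : Integrable (fun z : ℝ × ℝ³ =>
      ⟪U z.1 z.2 + W z.1 z.2, gradient (fun y => θ z.1 y + fderiv ℝ (θ z.1) y y) z.2⟫)
      (volume : Measure (ℝ × ℝ³)) :=
    integrable_inner_of_locallyIntegrableOn hu1 c3 h3.hasCompactSupport (hKQ _) z3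
  have I12 : Integrable (fun z : ℝ × ℝ³ => ⟪U z.1 z.2 + W z.1 z.2, gradient (timeDeriv θ z.1) z.2⟫ +
      ⟪U z.1 z.2 + W z.1 z.2, gradient (fun y => Δ (θ z.1) y) z.2⟫) (volume : Measure (ℝ × ℝ³)) :=
    I1.add I2
  have I123 : Integrable (fun z : ℝ × ℝ³ => ⟪U z.1 z.2 + W z.1 z.2, gradient (timeDeriv θ z.1) z.2⟫ +
      ⟪U z.1 z.2 + W z.1 z.2, gradient (fun y => Δ (θ z.1) y) z.2⟫ -
      ⟪U z.1 z.2 + W z.1 z.2, gradient (fun y => θ z.1 y + fderiv ℝ (θ z.1) y y) z.2⟫)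
      (volume : Measure (ℝ × ℝ³)) :=
    I12.sub I3
  have hzero : ∫ z : ℝ × ℝ³, (⟪U z.1 z.2 + W z.1 z.2, gradient (timeDeriv θ z.1) z.2⟫ +
      ⟪U z.1 z.2 + W z.1 z.2, gradient (fun y => Δ (θ z.1) y) z.2⟫ -
      ⟪U z.1 z.2 + W z.1 z.2, gradient (fun y => θ z.1 y + fderiv ℝ (θ z.1) y y) z.2⟫) = 0 := by
    rw [integral_sub I12 I3, integral_add I1 I2, hdiv _ h1, hdiv _ h2, hdiv _ h3]
    ring
  -- the Hessian terms are integrable (they are the drift terms)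
  have hψ := hθ.gradient_isSpaceTimeTestOn
  obtain ⟨-, -, -, I4, I5⟩ := integrable_lerayVeryWeak_terms hU1 hW1 hV1 hU2 hW2 hV2 hψ
  have I45 : Integrable (fun z : ℝ × ℝ³ =>
      fderiv ℝ (fderiv ℝ (θ z.1)) z.2 (W z.1 z.2 + V z.1 z.2) (U z.1 z.2) +
        fderiv ℝ (fderiv ℝ (θ z.1)) z.2 (U z.1 z.2 + W z.1 z.2) (W z.1 z.2))
      (volume : Measure (ℝ × ℝ³)) := by
    refine (I4.add I5).congr (Eventually.of_forall fun z => ?_)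
    show ⟪U z.1 z.2, convect (W z.1 + V z.1) (fun y => gradient (θ z.1) y) z.2⟫ +
        ⟪W z.1 z.2, convect (U z.1 + W z.1) (fun y => gradient (θ z.1) y) z.2⟫ = _
    exact congrArg₂ (· + ·) (inner_fderiv_gradient_apply₂ (hθ2 z.1) z.2 _ _)
      (inner_fderiv_gradient_apply₂ (hθ2 z.1) z.2 _ _)
  rw [integral_add I45 I123, hzero, add_zero, hpois θ hθ, neg_neg]

end Integrand

end BradshawTsai2017

/-! ### Box majorants: integrability and vanishing -/

section Majorants

variable {G : Type*} [NormedAddCommGroup G]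

/-- The box majorant `1_{[a,b]×B̄(0,R₀+r)} |F| C/rᵏ` of a function `F ∈ L^q([a, b] × ℝ³)`, `q ≥ 1`,
is integrable. [folklore] -/
theorem integrable_indicator_box_norm_mul {F : ℝ × ℝ³ → G} {q : ℝ≥0∞} (hq1 : 1 ≤ q) {a b : ℝ}
    (hF : MemLp F q (volume.restrict (Icc a b ×ˢ (univ : Set ℝ³)))) (R c : ℝ) :
    Integrable ((Icc a b ×ˢ closedBall (0 : ℝ³) R).indicator fun z => ‖F z‖ * c)
      (volume : Measure (ℝ × ℝ³)) := by
  set B : Set (ℝ × ℝ³) := Icc a b ×ˢ closedBall (0 : ℝ³) R with hB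
  have hBm : MeasurableSet B := measurableSet_Icc.prod measurableSet_closedBall
  have hBsub : B ⊆ Icc a b ×ˢ (univ : Set ℝ³) := prod_mono Subset.rfl (subset_univ _)
  have hBfin : volume B < ⊤ := by
    rw [hB, show (volume : Measure (ℝ × ℝ³)) = (volume : Measure ℝ).prod (volume : Measure ℝ³) from rfl,
      Measure.prod_prod]
    exact ENNReal.mul_lt_top (by rw [Real.volume_Icc]; exact ENNReal.ofReal_lt_top)
      measure_closedBall_lt_top
  haveI : IsFiniteMeasure (volume.restrict B) := isFiniteMeasure_restrict.2 hBfin.ne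
  have h1 : MemLp F q (volume.restrict B) := by
    have h := hF.restrict B
    rwa [Measure.restrict_restrict hBm, inter_eq_left.2 hBsub] at h
  have h2 : IntegrableOn F B volume := h1.integrable hq1
  rw [integrable_indicator_iff hBm]
  exact (h2.norm.mul_const c)

/-- **The box majorants vanish as `r → ∞`:** `∫∫ 1_{[a,b]×B̄(0,R₀+r)} |F| C/rᵏ → 0` for
`F ∈ L^q([a, b] × ℝ³)`, `1 ≤ q < ∞`, `k ≥ 3`. [folklore] -/
theorem tendsto_integral_indicator_box_norm_mul {F : ℝ × ℝ³ → G} {q : ℝ≥0∞} (hq1 : 1 ≤ q)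
    (hqtop : q ≠ ⊤) {a b : ℝ} (hF : MemLp F q (volume.restrict (Icc a b ×ˢ (univ : Set ℝ³))))
    {C R₀ : ℝ} {k : ℕ} (hk : 3 ≤ k) (hC : 0 ≤ C) (hR₀ : 0 ≤ R₀) :
    Tendsto (fun r : ℝ => ∫ z, (Icc a b ×ˢ closedBall (0 : ℝ³) (R₀ + r)).indicator
      (fun z => ‖F z‖ * (C / r ^ k)) z) atTop (𝓝 0) := by
  refine tendsto_integral_of_box_bound_memLp hq1 hqtop hF hk hC hR₀ (r₁ := 1)
    (fun r hr z hz => ?_) (fun r hr z hz => indicator_of_notMem hz _)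
  rw [indicator_of_mem hz, Real.norm_eq_abs, abs_of_nonneg]
  exact mul_nonneg (norm_nonneg _) (div_nonneg hC (pow_nonneg (zero_le_one.trans hr) _))

/-- **Domination by finitely many vanishing majorants** (used with the box majorants): if
`|Φ_r| ≤ M_r` pointwise for `r ≥ r₁`, `M_r` integrable and `∫∫ M_r → 0`, then `∫∫ Φ_r → 0`.
[folklore] -/
theorem tendsto_integral_zero_of_norm_le {Φ M : ℝ → ℝ × ℝ³ → ℝ} (r₁ : ℝ)
    (hM : ∀ r, r₁ ≤ r → Integrable (M r) (volume : Measure (ℝ × ℝ³)))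
    (hle : ∀ r, r₁ ≤ r → ∀ z, ‖Φ r z‖ ≤ M r z)
    (hlim : Tendsto (fun r => ∫ z, M r z) atTop (𝓝 0)) :
    Tendsto (fun r => ∫ z, Φ r z) atTop (𝓝 0) := by
  refine squeeze_zero_norm' ?_ hlim
  filter_upwards [eventually_ge_atTop r₁] with r hr
  exact norm_integral_le_of_norm_le (hM r hr) (Eventually.of_forall (hle r hr))

end Majorants

/-! ### Test-field bookkeeping on `ℝ × ℝ³`: the corrector and the corrected field -/

section CorrectedTop

variable {r : ℝ}

/-- The corrector `(t, x) ↦ e_{r₀,r₁}[ψ(t)](x)` of a test field on `ℝ × ℝ³` is a test field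
(`0 < r₀ < r₁`). [folklore] -/
theorem isSpaceTimeTestOn_farSmoothingField_top {r₀ r₁ : ℝ} {ψ : ℝ → ℝ³ → ℝ³}
    (hψ : IsSpaceTimeTestOn (⊤ : Opens (ℝ × ℝ³)) ψ) (h₀ : 0 < r₀) (h₁ : r₀ < r₁) :
    IsSpaceTimeTestOn (⊤ : Opens (ℝ × ℝ³)) (fun t x => farSmoothingField r₀ r₁ (ψ t) x) :=
  IsSpaceTimeTestOn.finsetSum Finset.univ fun i _ =>
    (((hψ.clm_left (innerSL ℝ (𝐛 i))).newtonFarSmoothing_top h₀ h₁).smul_const (𝐛 i))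

/-- `w_r[ψ]` is a space–time test field on `ℝ × ℝ³` when `ψ` is (`r > 0`). [folklore] -/
theorem isSpaceTimeTestOn_correctedTestField_top {ψ : ℝ → ℝ³ → ℝ³}
    (hψ : IsSpaceTimeTestOn (⊤ : Opens (ℝ × ℝ³)) ψ) (hr : 0 < r) :
    IsSpaceTimeTestOn (⊤ : Opens (ℝ × ℝ³)) (correctedTestField r ψ) :=
  (hψ.sub ((hψ.divergence_isSpaceTimeTestOn.newtonNearPotential_top (half_pos hr).le
    (half_lt_self hr)).gradient_isSpaceTimeTestOn)).sub
    (isSpaceTimeTestOn_farSmoothingField_top hψ (half_pos hr) (half_lt_self hr))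

variable {a b R₀ : ℝ}

/-- Off the box `[a, b] × B̄(0, R₀ + r)` the gradient of the corrector field vanishes (the
corrector vanishes on the open complement of the box in space, and identically for times
outside `[a, b]`). [folklore] -/
theorem fderiv_farSmoothingField_slice_eq_zero_of_notMem {ψ : ℝ → ℝ³ → ℝ³}
    (hψ0 : ∀ t y, (t, y) ∉ Icc a b ×ˢ closedBall (0 : ℝ³) R₀ → ψ t y = 0) (hr : 0 < r)
    {z : ℝ × ℝ³} (hz : z ∉ Icc a b ×ˢ closedBall (0 : ℝ³) (R₀ + r)) :
    fderiv ℝ (farSmoothingField (r / 2) r (ψ z.1)) z.2 = 0 := by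
  rw [Set.mem_prod, not_and_or] at hz
  rcases hz with ht | hx
  · -- time outside `[a, b]`: the whole slice vanishes
    have h0 : ∀ x, farSmoothingField (r / 2) r (ψ z.1) x = 0 := fun x =>
      farSmoothingField_slice_eq_zero_of_notMem (χ := ψ) (z := (z.1, x)) (R₀ := R₀) hψ0 hr
        (fun h => ht h.1)
    have : farSmoothingField (r / 2) r (ψ z.1) = fun _ => 0 := funext h0
    rw [this, fderiv_fun_const, Pi.zero_apply]
  · -- space outside the closed ball: vanishing on an open neighbourhood
    rw [mem_closedBall_zero_iff, not_le] at hx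
    have hopen : IsOpen {x : ℝ³ | R₀ + r < ‖x‖} := isOpen_lt continuous_const continuous_norm
    have hev : (farSmoothingField (r / 2) r (ψ z.1)) =ᶠ[𝓝 z.2] fun _ => 0 := by
      filter_upwards [hopen.mem_nhds hx] with x hx'
      exact farSmoothingField_slice_eq_zero_of_notMem (χ := ψ) (z := (z.1, x)) (R₀ := R₀) hψ0 hr
        (fun h => absurd (mem_closedBall_zero_iff.1 h.2) (not_le.2 hx'))
    rw [hev.fderiv_eq, fderiv_fun_const, Pi.zero_apply]

end CorrectedTop

namespace BradshawTsai2017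

/-! ### The remainder terms vanish as `r → ∞` -/

section Remainders

variable {U W V : ℝ → ℝ³ → ℝ³} {p : ℝ → ℝ³ → ℝ} {qU qW qV qp : ℝ≥0∞}

/-- **Term A: the pressure against the smoothing remainder of `div ψ` vanishes as `r → ∞`**
(`p ∈ L^q` of time slabs, `|Λ_r[div ψ]| = O(r⁻³)` on a box of volume `O(r³)`). [folklore] -/
theorem tendsto_integral_pressure_mul_farSmoothing (hqp : 1 ≤ qp) (hqp' : qp ≠ ⊤)
    (hp : ∀ a b : ℝ, MemLp (uncurry p) qp (volume.restrict (Icc a b ×ˢ (univ : Set ℝ³))))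
    {ψ : ℝ → ℝ³ → ℝ³} (hψ : IsSpaceTimeTestOn (⊤ : Opens (ℝ × ℝ³)) ψ) :
    Tendsto (fun r => ∫ z : ℝ × ℝ³, p z.1 z.2 *
      newtonFarSmoothing (r / 2) r (fun y => VectorCalculus.divergence (ψ z.1) y) z.2) atTop (𝓝 0) := by
  obtain ⟨a, b, R₀, hR₀, hT⟩ := hψ.exists_tsupport_subset_box_top
  have hg := hψ.divergence_isSpaceTimeTestOn
  obtain ⟨C, hC0, hC⟩ := exists_abs_newtonFarSmoothing_slice_le hg
  obtain ⟨-, hg0⟩ := hψ.continuous_divergence_field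
  have hg0' : ∀ t y, (t, y) ∉ Icc a b ×ˢ closedBall (0 : ℝ³) R₀ →
      VectorCalculus.divergence (ψ t) y = 0 := fun t y hty => hg0 (t, y) fun h => hty (hT h)
  refine tendsto_integral_of_box_bound_memLp (F := uncurry p) hqp hqp' (hp a b) (k := 3) le_rfl hC0
    hR₀ (r₁ := 1) (fun r hr z _ => ?_) (fun r hr z hz => ?_)
  · rw [norm_mul]
    exact mul_le_mul_of_nonneg_left (hC (one_pos.trans_le hr) z.1 z.2) (norm_nonneg _)
  · rw [newtonFarSmoothing_slice_eq_zero_of_notMem hg0' (one_pos.trans_le hr) hz, mul_zero]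

/-- **Terms B: the very weak integrand against the corrector `e_r[ψ]` vanishes as `r → ∞`.** On
the box `[a, b] × B̄(0, R₀ + r)` carrying `e_r[ψ]`: `∂ₛe_r = e_r[∂ₛψ]`, `Δe_r = e_r[Δψ]`, `e_r` are
`O(r⁻³)`, `De_r` is `O(r⁻⁴)` and `|y| ≤ 2r`, so
`|W(e_r[ψ])| ≤ (|U| + |W|) K/r³ + (|U|² + |W|² + |V|²) K'/r⁴`; each box majorant vanishes in the
limit by Hölder against the volume `O(r³)` of the box. [folklore] -/
theorem tendsto_integral_lerayVeryWeakIntegrand_farSmoothingField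
    (hqU : 2 ≤ qU) (hqU' : qU ≠ ⊤) (hqW : 2 ≤ qW) (hqW' : qW ≠ ⊤) (hqV : 2 ≤ qV) (hqV' : qV ≠ ⊤)
    (hU : ∀ a b : ℝ, MemLp (uncurry U) qU (volume.restrict (Icc a b ×ˢ (univ : Set ℝ³))))
    (hW : ∀ a b : ℝ, MemLp (uncurry W) qW (volume.restrict (Icc a b ×ˢ (univ : Set ℝ³))))
    (hV : ∀ a b : ℝ, MemLp (uncurry V) qV (volume.restrict (Icc a b ×ˢ (univ : Set ℝ³))))
    {ψ : ℝ → ℝ³ → ℝ³} (hψ : IsSpaceTimeTestOn (⊤ : Opens (ℝ × ℝ³)) ψ) :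
    Tendsto (fun r => ∫ z : ℝ × ℝ³,
      lerayVeryWeakIntegrand U W V (fun t x => farSmoothingField (r / 2) r (ψ t) x) z) atTop (𝓝 0) := by
  obtain ⟨a, b, R₀, hR₀, hT⟩ := hψ.exists_tsupport_subset_box_top
  have hψ0 : ∀ t y, (t, y) ∉ Icc a b ×ˢ closedBall (0 : ℝ³) R₀ → ψ t y = 0 :=
    fun t y hty => (image_eq_zero_of_notMem_tsupport fun h => hty (hT h) : uncurry ψ (t, y) = 0)
  -- the derived test fields and their supports
  have hdt := hψ.timeDeriv_top
  have hlap := hψ.laplacian_top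
  have hdt0 : ∀ t y, (t, y) ∉ Icc a b ×ˢ closedBall (0 : ℝ³) R₀ → timeDeriv ψ t y = 0 :=
    fun t y hty => IsSpaceTimeTestOn.timeDeriv_eq_zero_of_notMem (ψ := ψ) fun h => hty (hT h)
  have hlap0 : ∀ t y, (t, y) ∉ Icc a b ×ˢ closedBall (0 : ℝ³) R₀ → Δ (ψ t) y = 0 :=
    fun t y hty => laplacian_slice_eq_zero_of_notMem_tsupport fun h => hty (hT h)
  obtain ⟨C₀, hC₀0, hC₀⟩ := exists_norm_farSmoothingField_slice_le hψ
  obtain ⟨C₁, hC₁0, hC₁⟩ := exists_norm_farSmoothingField_slice_le hdt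
  obtain ⟨C₃, hC₃0, hC₃⟩ := exists_norm_farSmoothingField_slice_le hlap
  obtain ⟨C₄, hC₄0, hC₄⟩ := exists_norm_fderiv_farSmoothingField_le hψ
  -- exponents of the squares
  have h2U : 1 ≤ qU / 2 := by
    rw [ENNReal.le_div_iff_mul_le (Or.inl two_ne_zero) (Or.inl ENNReal.ofNat_ne_top), one_mul]; exact hqU
  have h2W : 1 ≤ qW / 2 := by
    rw [ENNReal.le_div_iff_mul_le (Or.inl two_ne_zero) (Or.inl ENNReal.ofNat_ne_top), one_mul]; exact hqW
  have h2V : 1 ≤ qV / 2 := by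
    rw [ENNReal.le_div_iff_mul_le (Or.inl two_ne_zero) (Or.inl ENNReal.ofNat_ne_top), one_mul]; exact hqV
  have h2U' : qU / 2 ≠ ⊤ := ENNReal.div_ne_top hqU' two_ne_zero
  have h2W' : qW / 2 ≠ ⊤ := ENNReal.div_ne_top hqW' two_ne_zero
  have h2V' : qV / 2 ≠ ⊤ := ENNReal.div_ne_top hqV' two_ne_zero
  have h1U : 1 ≤ qU := one_le_two.trans hqU
  have h1W : 1 ≤ qW := one_le_two.trans hqW
  -- the constants of the two groups of majorants
  set K₁ : ℝ := C₁ + C₃ + 2 * C₀ + 2 * C₄ with hK₁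
  set K₂ : ℝ := 2 * C₄ with hK₂
  have hK₁0 : 0 ≤ K₁ := by positivity
  have hK₂0 : 0 ≤ K₂ := by positivity
  -- the five box majorants
  set mU : ℝ → ℝ × ℝ³ → ℝ := fun r =>
    (Icc a b ×ˢ closedBall (0 : ℝ³) (R₀ + r)).indicator fun z => ‖uncurry U z‖ * (K₁ / r ^ 3) with hmU
  set mW : ℝ → ℝ × ℝ³ → ℝ := fun r =>
    (Icc a b ×ˢ closedBall (0 : ℝ³) (R₀ + r)).indicator fun z => ‖uncurry W z‖ * (K₁ / r ^ 3) with hmW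
  set mU2 : ℝ → ℝ × ℝ³ → ℝ := fun r =>
    (Icc a b ×ˢ closedBall (0 : ℝ³) (R₀ + r)).indicator
      fun z => ‖(fun z => ‖uncurry U z‖ ^ 2) z‖ * (K₂ / r ^ 4) with hmU2
  set mW2 : ℝ → ℝ × ℝ³ → ℝ := fun r =>
    (Icc a b ×ˢ closedBall (0 : ℝ³) (R₀ + r)).indicator
      fun z => ‖(fun z => ‖uncurry W z‖ ^ 2) z‖ * (K₂ / r ^ 4) with hmW2
  set mV2 : ℝ → ℝ × ℝ³ → ℝ := fun r =>
    (Icc a b ×ˢ closedBall (0 : ℝ³) (R₀ + r)).indicator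
      fun z => ‖(fun z => ‖uncurry V z‖ ^ 2) z‖ * (K₂ / r ^ 4) with hmV2
  have IU : ∀ r, Integrable (mU r) (volume : Measure (ℝ × ℝ³)) := fun r =>
    integrable_indicator_box_norm_mul h1U (hU a b) (R₀ + r) (K₁ / r ^ 3)
  have IW : ∀ r, Integrable (mW r) (volume : Measure (ℝ × ℝ³)) := fun r =>
    integrable_indicator_box_norm_mul h1W (hW a b) (R₀ + r) (K₁ / r ^ 3)
  have IU2 : ∀ r, Integrable (mU2 r) (volume : Measure (ℝ × ℝ³)) := fun r =>
    integrable_indicator_box_norm_mul h2U (memLp_norm_sq_of_memLp (hU a b)) (R₀ + r) (K₂ / r ^ 4)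
  have IW2 : ∀ r, Integrable (mW2 r) (volume : Measure (ℝ × ℝ³)) := fun r =>
    integrable_indicator_box_norm_mul h2W (memLp_norm_sq_of_memLp (hW a b)) (R₀ + r) (K₂ / r ^ 4)
  have IV2 : ∀ r, Integrable (mV2 r) (volume : Measure (ℝ × ℝ³)) := fun r =>
    integrable_indicator_box_norm_mul h2V (memLp_norm_sq_of_memLp (hV a b)) (R₀ + r) (K₂ / r ^ 4)
  have TU : Tendsto (fun r => ∫ z, mU r z) atTop (𝓝 0) :=
    tendsto_integral_indicator_box_norm_mul h1U hqU' (hU a b) (k := 3) le_rfl hK₁0 hR₀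
  have TW : Tendsto (fun r => ∫ z, mW r z) atTop (𝓝 0) :=
    tendsto_integral_indicator_box_norm_mul h1W hqW' (hW a b) (k := 3) le_rfl hK₁0 hR₀
  have TU2 : Tendsto (fun r => ∫ z, mU2 r z) atTop (𝓝 0) :=
    tendsto_integral_indicator_box_norm_mul h2U h2U' (memLp_norm_sq_of_memLp (hU a b))
      (k := 4) (by norm_num) hK₂0 hR₀
  have TW2 : Tendsto (fun r => ∫ z, mW2 r z) atTop (𝓝 0) :=
    tendsto_integral_indicator_box_norm_mul h2W h2W' (memLp_norm_sq_of_memLp (hW a b))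
      (k := 4) (by norm_num) hK₂0 hR₀
  have TV2 : Tendsto (fun r => ∫ z, mV2 r z) atTop (𝓝 0) :=
    tendsto_integral_indicator_box_norm_mul h2V h2V' (memLp_norm_sq_of_memLp (hV a b))
      (k := 4) (by norm_num) hK₂0 hR₀
  set M : ℝ → ℝ × ℝ³ → ℝ := fun r => mU r + mW r + mU2 r + mW2 r + mV2 r with hM
  have hMint : ∀ r, Integrable (M r) (volume : Measure (ℝ × ℝ³)) := fun r =>
    ((((IU r).add (IW r)).add (IU2 r)).add (IW2 r)).add (IV2 r)
  have hMlim : Tendsto (fun r => ∫ z, M r z) atTop (𝓝 0) := by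
    have h := (((TU.add TW).add TU2).add TW2).add TV2
    simp only [add_zero] at h
    refine h.congr fun r => ?_
    rw [hM, integral_add' ((((IU r).add (IW r)).add (IU2 r)).add (IW2 r)) (IV2 r),
      integral_add' (((IU r).add (IW r)).add (IU2 r)) (IW2 r),
      integral_add' ((IU r).add (IW r)) (IU2 r), integral_add' (IU r) (IW r)]
  refine tendsto_integral_zero_of_norm_le (max R₀ 1) (fun r _ => hMint r) (fun r hr z => ?_) hMlim
  -- ## the pointwise domination for `r ≥ max R₀ 1`
  have hr1 : 1 ≤ r := (le_max_right _ _).trans hr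
  have hr0 : 0 < r := one_pos.trans_le hr1
  have hRr : R₀ ≤ r := (le_max_left _ _).trans hr
  have h₀ : 0 < r / 2 := half_pos hr0
  have h₁ : r / 2 < r := half_lt_self hr0
  by_cases hz : z ∈ Icc a b ×ˢ closedBall (0 : ℝ³) (R₀ + r)
  · -- on the box
    have hind : ∀ f : ℝ × ℝ³ → ℝ, (Icc a b ×ˢ closedBall (0 : ℝ³) (R₀ + r)).indicator f z = f z :=
      fun f => indicator_of_mem hz f
    rw [hM]
    simp only [Pi.add_apply, hmU, hmW, hmU2, hmW2, hmV2, hind]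
    obtain ⟨t, x⟩ := z
    have hx : ‖x‖ ≤ 2 * r := by
      have := mem_closedBall_zero_iff.1 hz.2
      linarith
    rw [lerayVeryWeakIntegrand_apply]
    simp only [uncurry_apply_pair]
    -- the five slice identities / bounds at `(t, x)`
    have hψ2 : ContDiff ℝ 2 (ψ t) := (hψ.contDiff_slice t).of_le (by norm_cast)
    have e_dt : timeDeriv (fun s y => farSmoothingField (r / 2) r (ψ s) y) t x =
        farSmoothingField (r / 2) r (timeDeriv ψ t) x := timeDeriv_farSmoothingField h₀ h₁ hψ t x
    have e_lap : Δ (fun y => farSmoothingField (r / 2) r (ψ t) y) x =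
        farSmoothingField (r / 2) r (Δ (ψ t)) x := laplacian_farSmoothingField h₀ h₁ hψ2 x
    set e := farSmoothingField (r / 2) r (ψ t) x with he
    set D := fderiv ℝ (fun y => farSmoothingField (r / 2) r (ψ t) y) x with hDdef
    have nU := norm_nonneg (U t x)
    have nW := norm_nonneg (W t x)
    have nV := norm_nonneg (V t x)
    have b_dt : ‖farSmoothingField (r / 2) r (timeDeriv ψ t) x‖ ≤ C₁ / r ^ 3 := hC₁ hr0 t x
    have b_lap : ‖farSmoothingField (r / 2) r (Δ (ψ t)) x‖ ≤ C₃ / r ^ 3 := hC₃ hr0 t x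
    have b_e : ‖e‖ ≤ C₀ / r ^ 3 := hC₀ hr0 t x
    have b_D : ‖D‖ ≤ C₄ / r ^ 4 := hC₄ hr0 t x
    have hr3 : 0 < r ^ 3 := by positivity
    have hr4 : 0 < r ^ 4 := by positivity
    have b_Dx : ‖D x‖ ≤ 2 * C₄ / r ^ 3 := by
      calc ‖D x‖ ≤ ‖D‖ * ‖x‖ := D.le_opNorm x
        _ ≤ C₄ / r ^ 4 * (2 * r) := mul_le_mul b_D hx (norm_nonneg _) (by positivity)
        _ = 2 * C₄ / r ^ 3 := by field_simp
    -- term by term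
    have t1 : ‖⟪U t x + W t x, farSmoothingField (r / 2) r (timeDeriv ψ t) x⟫‖ ≤
        (‖U t x‖ + ‖W t x‖) * (C₁ / r ^ 3) :=
      (norm_inner_le_norm _ _).trans (mul_le_mul (norm_add_le _ _) b_dt (norm_nonneg _) (by positivity))
    have t2 : ‖⟪U t x + W t x, farSmoothingField (r / 2) r (Δ (ψ t)) x⟫‖ ≤
        (‖U t x‖ + ‖W t x‖) * (C₃ / r ^ 3) :=
      (norm_inner_le_norm _ _).trans (mul_le_mul (norm_add_le _ _) b_lap (norm_nonneg _) (by positivity))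
    have t3 : ‖⟪U t x + W t x, (2 : ℝ) • e + D x⟫‖ ≤
        (‖U t x‖ + ‖W t x‖) * (2 * C₀ / r ^ 3 + 2 * C₄ / r ^ 3) := by
      refine (norm_inner_le_norm _ _).trans (mul_le_mul (norm_add_le _ _) ?_ (norm_nonneg _) (by positivity))
      refine (norm_add_le _ _).trans (add_le_add ?_ b_Dx)
      rw [norm_smul, Real.norm_eq_abs, abs_of_pos two_pos, mul_div_assoc]
      exact mul_le_mul_of_nonneg_left b_e zero_le_two
    have t4 : ‖⟪U t x, D (W t x + V t x)⟫‖ ≤ ‖U t x‖ * (C₄ / r ^ 4 * (‖W t x‖ + ‖V t x‖)) := by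
      refine (norm_inner_le_norm _ _).trans (mul_le_mul_of_nonneg_left ?_ nU)
      exact (D.le_opNorm _).trans (mul_le_mul b_D (norm_add_le _ _) (norm_nonneg _) (by positivity))
    have t5 : ‖⟪W t x, D (U t x + W t x)⟫‖ ≤ ‖W t x‖ * (C₄ / r ^ 4 * (‖U t x‖ + ‖W t x‖)) := by
      refine (norm_inner_le_norm _ _).trans (mul_le_mul_of_nonneg_left ?_ nW)
      exact (D.le_opNorm _).trans (mul_le_mul b_D (norm_add_le _ _) (norm_nonneg _) (by positivity))
    -- the convective terms in the form they appear
    have e4 : convect (W t + V t) (fun y => farSmoothingField (r / 2) r (ψ t) y) x = D (W t x + V t x) := rfl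
    have e5 : convect (U t + W t) (fun y => farSmoothingField (r / 2) r (ψ t) y) x = D (U t x + W t x) := rfl
    rw [e_dt, e_lap, e4, e5]
    -- Young for the products
    have yUW : 2 * ‖U t x‖ * ‖W t x‖ ≤ ‖U t x‖ ^ 2 + ‖W t x‖ ^ 2 := two_mul_le_add_sq _ _
    have yUV : 2 * ‖U t x‖ * ‖V t x‖ ≤ ‖U t x‖ ^ 2 + ‖V t x‖ ^ 2 := two_mul_le_add_sq _ _
    have hsq : ∀ s : ℝ, ‖s ^ 2‖ = s ^ 2 := fun s => by rw [Real.norm_eq_abs, abs_of_nonneg (sq_nonneg _)]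
    rw [hsq, hsq, hsq]
    have hC4r : 0 ≤ C₄ / r ^ 4 := by positivity
    calc ‖⟪U t x + W t x, farSmoothingField (r / 2) r (timeDeriv ψ t) x⟫ +
            ⟪U t x + W t x, farSmoothingField (r / 2) r (Δ (ψ t)) x⟫ -
            ⟪U t x + W t x, (2 : ℝ) • e + D x⟫ + ⟪U t x, D (W t x + V t x)⟫ +
            ⟪W t x, D (U t x + W t x)⟫‖
        ≤ ‖⟪U t x + W t x, farSmoothingField (r / 2) r (timeDeriv ψ t) x⟫‖ +
            ‖⟪U t x + W t x, farSmoothingField (r / 2) r (Δ (ψ t)) x⟫‖ +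
            ‖⟪U t x + W t x, (2 : ℝ) • e + D x⟫‖ + ‖⟪U t x, D (W t x + V t x)⟫‖ +
            ‖⟪W t x, D (U t x + W t x)⟫‖ := by
          refine (norm_add_le _ _).trans (add_le_add ?_ le_rfl)
          refine (norm_add_le _ _).trans (add_le_add ?_ le_rfl)
          refine (norm_sub_le _ _).trans (add_le_add ?_ le_rfl)
          exact norm_add_le _ _
      _ ≤ (‖U t x‖ + ‖W t x‖) * (C₁ / r ^ 3) + (‖U t x‖ + ‖W t x‖) * (C₃ / r ^ 3) +
            (‖U t x‖ + ‖W t x‖) * (2 * C₀ / r ^ 3 + 2 * C₄ / r ^ 3) +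
            ‖U t x‖ * (C₄ / r ^ 4 * (‖W t x‖ + ‖V t x‖)) +
            ‖W t x‖ * (C₄ / r ^ 4 * (‖U t x‖ + ‖W t x‖)) := by
          gcongr
      _ = ‖U t x‖ * (K₁ / r ^ 3) + ‖W t x‖ * (K₁ / r ^ 3) +
            C₄ / r ^ 4 * (2 * ‖U t x‖ * ‖W t x‖ + ‖U t x‖ * ‖V t x‖ + ‖W t x‖ ^ 2) := by
          rw [hK₁]; field_simp; ring
      _ ≤ ‖U t x‖ * (K₁ / r ^ 3) + ‖W t x‖ * (K₁ / r ^ 3) +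
            C₄ / r ^ 4 * (2 * (‖U t x‖ ^ 2 + ‖W t x‖ ^ 2 + ‖V t x‖ ^ 2)) := by
          gcongr
          nlinarith [sq_nonneg (‖U t x‖), sq_nonneg (‖W t x‖), sq_nonneg (‖V t x‖)]
      _ = ‖U t x‖ * (K₁ / r ^ 3) + ‖W t x‖ * (K₁ / r ^ 3) + ‖U t x‖ ^ 2 * (K₂ / r ^ 4) +
            ‖W t x‖ ^ 2 * (K₂ / r ^ 4) + ‖V t x‖ ^ 2 * (K₂ / r ^ 4) := by
          rw [hK₂]; ring
  · -- off the box everything vanishes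
    have hM0 : M r z = 0 := by
      rw [hM]; simp only [Pi.add_apply, hmU, hmW, hmU2, hmW2, hmV2, indicator_of_notMem hz, add_zero]
    rw [hM0]
    refine le_of_eq (norm_eq_zero.2 ?_)
    rw [lerayVeryWeakIntegrand_apply]
    have hψ2 : ContDiff ℝ 2 (ψ z.1) := (hψ.contDiff_slice z.1).of_le (by norm_cast)
    rw [timeDeriv_farSmoothingField h₀ h₁ hψ,
      show (fun y => farSmoothingField (r / 2) r (ψ z.1) y) = farSmoothingField (r / 2) r (ψ z.1) from rfl,
      laplacian_farSmoothingField h₀ h₁ hψ2,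
      farSmoothingField_slice_eq_zero_of_notMem hdt0 hr0 hz,
      farSmoothingField_slice_eq_zero_of_notMem hlap0 hr0 hz,
      farSmoothingField_slice_eq_zero_of_notMem hψ0 hr0 hz]
    simp only [convect, fderiv_farSmoothingField_slice_eq_zero_of_notMem hψ0 hr0 hz]
    simp

end Remainders

end BradshawTsai2017

namespace BradshawTsai2017

/-! ### The main theorem -/

section Main

variable {U W V : ℝ → ℝ³ → ℝ³} {p : ℝ → ℝ³ → ℝ} {qU qW qV qp : ℝ≥0∞}

/-- **Very weak solutions of the mollified perturbed Leray system with a Riesz-type pressure are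
distributional solutions** ([BT1], proof of Thm 2.4: "Note that `p_ε` is defined as a
distribution whenever `U_ε` is a weak solution … this implies `∇(p_ε − p̃_ε) = 0`. We may
therefore replace `p_ε` by `p̃_ε`", where `p̃_ε = Σ RᵢRⱼ[(η_ε*Uᵢ)Uⱼ + WᵢUⱼ + UᵢWⱼ + WᵢWⱼ]`; realised,
as in the tree's `isDistributionalNSSolutionOn_slab_of_veryWeak` for the Navier–Stokes equations,
with compactly supported objects only). Let `U`, `W`, `V` (in [BT1]: the unknown `U_ε`, the
revised profile `W` of Lemma 2.5, and the mollified field `η_ε * U_ε`) belong to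
`L^{q}([a, b] × ℝ³)` for all `a < b` with exponents `q ≥ 2` (finite), and `p ∈ L^{q_p}([a,b] × ℝ³)`,
`1 ≤ q_p < ∞`. Put `u = U + W`, `b = W + V`, and assume on `ℝ × ℝ³`: `div u = 0` weakly
(`∫∫ ⟪u, ∇θ⟫ = 0`), the weak pressure Poisson equation
`∫∫ p Δθ = −∫∫ (D²θ(b, U) + D²θ(u, W))` for all `θ ∈ C_c^∞(ℝ × ℝ³)` (`−Δp = ∂ᵢ∂ⱼ(bᵢUⱼ + uᵢWⱼ)`,
i.e. `p` is the Riesz pressure `p̃` slice-wise), and the very weak (pressure-free) form of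
`∂ₛu − Δu − u − y·∇u + b·∇U + u·∇W + ∇p = 0`,
`∫∫ ⟪u, ∂ₛψ + Δψ⟫ − ⟪u, 2ψ + (y·∇)ψ⟫ + ⟪U, (b·∇)ψ⟫ + ⟪W, (u·∇)ψ⟫ = 0`, for every test field
`ψ ∈ C_c^∞(ℝ × ℝ³; ℝ³)` with divergence-free slices. Then the pressure-explicit equation holds
against every test field `ψ` — the `distributional` clause of
`IsMollifiedPeriodicWeakSolution` (with `V = mollify η ε U`). Proof: for `r > 0` the corrected
field `w_r = ψ − ∇N_{r/2,r}[div ψ] − e_{r/2,r}[ψ]` is an admissible divergence-free test field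
(`correctedTestField`); the gradient part contributes exactly `−∫∫ p ΔN[div ψ] =
−∫∫ p div ψ + ∫∫ p Λ_r[div ψ]` (`integral_lerayVeryWeakIntegrand_gradient`: the Leray terms
`2∇φ + (y·∇)∇φ = ∇(φ + y·∇φ)` pair to zero with `u`), and the remainders are `O(r^{−a})`, `a > 0`
(the dilation term through the kernel-gradient bound `|Dλ_{r/2,r}| ≤ S/r⁴` and `|y| ≤ 2r` on the
box), so `r → ∞` gives the identity. [cite: BradshawTsai2017AHP, proof of Thm 2.4 ("∇(p_ε − p̃_ε) = 0. We may therefore replace p_ε by p̃_ε")] -/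
theorem distributional_of_veryWeak
    (hqU : 2 ≤ qU) (hqU' : qU ≠ ⊤) (hqW : 2 ≤ qW) (hqW' : qW ≠ ⊤) (hqV : 2 ≤ qV) (hqV' : qV ≠ ⊤)
    (hqp : 1 ≤ qp) (hqp' : qp ≠ ⊤)
    (hU : ∀ a b : ℝ, MemLp (uncurry U) qU (volume.restrict (Icc a b ×ˢ (univ : Set ℝ³))))
    (hW : ∀ a b : ℝ, MemLp (uncurry W) qW (volume.restrict (Icc a b ×ˢ (univ : Set ℝ³))))
    (hV : ∀ a b : ℝ, MemLp (uncurry V) qV (volume.restrict (Icc a b ×ˢ (univ : Set ℝ³))))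
    (hp : ∀ a b : ℝ, MemLp (uncurry p) qp (volume.restrict (Icc a b ×ˢ (univ : Set ℝ³))))
    (hdiv : ∀ θ : ℝ → ℝ³ → ℝ, IsSpaceTimeTestOn (⊤ : Opens (ℝ × ℝ³)) θ →
      ∫ z : ℝ × ℝ³, ⟪U z.1 z.2 + W z.1 z.2, gradient (θ z.1) z.2⟫ = 0)
    (hpois : ∀ θ : ℝ → ℝ³ → ℝ, IsSpaceTimeTestOn (⊤ : Opens (ℝ × ℝ³)) θ →
      ∫ z : ℝ × ℝ³, p z.1 z.2 * Δ (θ z.1) z.2 =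
        -∫ z : ℝ × ℝ³, (fderiv ℝ (fderiv ℝ (θ z.1)) z.2 (W z.1 z.2 + V z.1 z.2) (U z.1 z.2) +
          fderiv ℝ (fderiv ℝ (θ z.1)) z.2 (U z.1 z.2 + W z.1 z.2) (W z.1 z.2)))
    (hweak : ∀ ψ : ℝ → ℝ³ → ℝ³, IsSpaceTimeTestOn (⊤ : Opens (ℝ × ℝ³)) ψ →
      (∀ t, VectorCalculus.IsDivFree (ψ t)) →
      ∫ z : ℝ × ℝ³, (⟪U z.1 z.2 + W z.1 z.2, timeDeriv ψ z.1 z.2⟫ +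
        ⟪U z.1 z.2 + W z.1 z.2, Δ (ψ z.1) z.2⟫ -
        ⟪U z.1 z.2 + W z.1 z.2, (2 : ℝ) • ψ z.1 z.2 + fderiv ℝ (ψ z.1) z.2 z.2⟫ +
        ⟪U z.1 z.2, convect (W z.1 + V z.1) (ψ z.1) z.2⟫ +
        ⟪W z.1 z.2, convect (U z.1 + W z.1) (ψ z.1) z.2⟫) = 0)
    {ψ : ℝ → ℝ³ → ℝ³} (hψ : IsSpaceTimeTestOn (⊤ : Opens (ℝ × ℝ³)) ψ) :
    ∫ z : ℝ × ℝ³, (⟪U z.1 z.2 + W z.1 z.2, timeDeriv ψ z.1 z.2⟫ +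
      ⟪U z.1 z.2 + W z.1 z.2, Δ (ψ z.1) z.2⟫ -
      ⟪U z.1 z.2 + W z.1 z.2, (2 : ℝ) • ψ z.1 z.2 + fderiv ℝ (ψ z.1) z.2 z.2⟫ +
      ⟪U z.1 z.2, convect (W z.1 + V z.1) (ψ z.1) z.2⟫ +
      ⟪W z.1 z.2, convect (U z.1 + W z.1) (ψ z.1) z.2⟫ +
      p z.1 z.2 * VectorCalculus.divergence (ψ z.1) z.2) = 0 := by
  -- local classes
  obtain ⟨hU1, hU2⟩ := locallyIntegrable_and_sq_of_memLp_slab hqU hU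
  obtain ⟨hW1, hW2⟩ := locallyIntegrable_and_sq_of_memLp_slab hqW hW
  obtain ⟨hV1, hV2⟩ := locallyIntegrable_and_sq_of_memLp_slab hqV hV
  have hp1 : LocallyIntegrableOn (uncurry p) ((⊤ : Opens (ℝ × ℝ³)) : Set (ℝ × ℝ³)) volume :=
    (locallyIntegrable_of_memLp_slab hqp hp).locallyIntegrableOn _
  have hKQ : ∀ K : Set (ℝ × ℝ³), K ⊆ ((⊤ : Opens (ℝ × ℝ³)) : Set (ℝ × ℝ³)) := fun _ _ _ => trivial
  -- notation
  set g : ℝ → ℝ³ → ℝ := fun t x => VectorCalculus.divergence (ψ t) x with hg_def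
  have hg : IsSpaceTimeTestOn (⊤ : Opens (ℝ × ℝ³)) g := hψ.divergence_isSpaceTimeTestOn
  -- the target integrand is `W(ψ) + p g`
  show ∫ z : ℝ × ℝ³, (lerayVeryWeakIntegrand U W V ψ z + p z.1 z.2 * g z.1 z.2) = 0
  have IW := integrable_lerayVeryWeakIntegrand hU1 hW1 hV1 hU2 hW2 hV2 hψ
  obtain ⟨cg, hg0⟩ := hψ.continuous_divergence_field
  have Ipg : Integrable (fun z : ℝ × ℝ³ => p z.1 z.2 * g z.1 z.2) (volume : Measure (ℝ × ℝ³)) :=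
    integrable_mul_of_locallyIntegrableOn (F := uncurry p) hp1 cg hψ.hasCompactSupport (hKQ _) hg0
  rw [integral_add IW Ipg]
  -- ## the key identity at scale `r > 0`
  have key : ∀ r : ℝ, 0 < r →
      (∫ z, lerayVeryWeakIntegrand U W V ψ z) + ∫ z : ℝ × ℝ³, p z.1 z.2 * g z.1 z.2 =
      (∫ z : ℝ × ℝ³, p z.1 z.2 * newtonFarSmoothing (r / 2) r (g z.1) z.2) +
        ∫ z, lerayVeryWeakIntegrand U W V (fun t x => farSmoothingField (r / 2) r (ψ t) x) z := by
    intro r hr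
    have h₀ : 0 < r / 2 := half_pos hr
    have h₁ : r / 2 < r := half_lt_self hr
    -- the pieces of `w_r`
    have hφ : IsSpaceTimeTestOn (⊤ : Opens (ℝ × ℝ³))
        (fun t => newtonNearPotential (r / 2) r (g t)) := hg.newtonNearPotential_top h₀.le h₁
    have hΛ : IsSpaceTimeTestOn (⊤ : Opens (ℝ × ℝ³))
        (fun t => newtonFarSmoothing (r / 2) r (g t)) := hg.newtonFarSmoothing_top h₀ h₁
    have hgradφ := hφ.gradient_isSpaceTimeTestOn
    have he := isSpaceTimeTestOn_farSmoothingField_top hψ h₀ h₁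
    have hw := isSpaceTimeTestOn_correctedTestField_top hψ hr
    -- `hweak` for `w_r`, split into three integrals
    have hzero := hweak (correctedTestField r ψ) hw (isDivFree_correctedTestField hψ hr)
    have hsplit : ∀ z : ℝ × ℝ³,
        ⟪U z.1 z.2 + W z.1 z.2, timeDeriv (correctedTestField r ψ) z.1 z.2⟫ +
          ⟪U z.1 z.2 + W z.1 z.2, Δ (correctedTestField r ψ z.1) z.2⟫ -
          ⟪U z.1 z.2 + W z.1 z.2, (2 : ℝ) • correctedTestField r ψ z.1 z.2 +
            fderiv ℝ (correctedTestField r ψ z.1) z.2 z.2⟫ +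
          ⟪U z.1 z.2, convect (W z.1 + V z.1) (correctedTestField r ψ z.1) z.2⟫ +
          ⟪W z.1 z.2, convect (U z.1 + W z.1) (correctedTestField r ψ z.1) z.2⟫ =
        lerayVeryWeakIntegrand U W V ψ z -
          lerayVeryWeakIntegrand U W V
            (fun t x => gradient (newtonNearPotential (r / 2) r (g t)) x) z -
          lerayVeryWeakIntegrand U W V (fun t x => farSmoothingField (r / 2) r (ψ t) x) z := by
      intro z
      rw [← lerayVeryWeakIntegrand_apply, ← lerayVeryWeakIntegrand_sub hψ hgradφ z,
        ← lerayVeryWeakIntegrand_sub (hψ.sub hgradφ) he z]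
      rfl
    simp_rw [hsplit] at hzero
    have IW1 := integrable_lerayVeryWeakIntegrand hU1 hW1 hV1 hU2 hW2 hV2 hgradφ
    have IW2 := integrable_lerayVeryWeakIntegrand hU1 hW1 hV1 hU2 hW2 hV2 he
    rw [integral_sub (f := fun z => lerayVeryWeakIntegrand U W V ψ z -
        lerayVeryWeakIntegrand U W V (fun t x => gradient (newtonNearPotential (r / 2) r (g t)) x) z)
        (g := lerayVeryWeakIntegrand U W V (fun t x => farSmoothingField (r / 2) r (ψ t) x))
        (IW.sub IW1) IW2,
      integral_sub IW IW1] at hzero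
    have hG := integral_lerayVeryWeakIntegrand_gradient hU1 hW1 hV1 hU2 hW2 hV2 hdiv hpois hφ
    rw [hG] at hzero
    -- the pressure against `ΔN[g] = g - Λ[g]`
    have IpΛ : Integrable (fun z : ℝ × ℝ³ => p z.1 z.2 * newtonFarSmoothing (r / 2) r (g z.1) z.2)
        (volume : Measure (ℝ × ℝ³)) :=
      integrable_mul_of_locallyIntegrableOn (F := uncurry p) hp1 hΛ.contDiff.continuous
        hΛ.hasCompactSupport (hKQ _) fun z hz =>
          show uncurry (fun t => newtonFarSmoothing (r / 2) r (g t)) z = 0 from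
            image_eq_zero_of_notMem_tsupport hz
    have hlapN : ∀ z : ℝ × ℝ³, p z.1 z.2 * Δ (newtonNearPotential (r / 2) r (g z.1)) z.2 =
        p z.1 z.2 * g z.1 z.2 - p z.1 z.2 * newtonFarSmoothing (r / 2) r (g z.1) z.2 := by
      intro z
      rw [laplacian_newtonNearPotential h₀ h₁ ((hg.contDiff_slice z.1).of_le (by norm_cast)), mul_sub]
    simp_rw [hlapN] at hzero
    rw [integral_sub Ipg IpΛ] at hzero
    linarith
  -- ## the remainder vanishes
  have hlim := (tendsto_integral_pressure_mul_farSmoothing hqp hqp' hp hψ).add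
    (tendsto_integral_lerayVeryWeakIntegrand_farSmoothingField hqU hqU' hqW hqW' hqV hqV' hU hW hV hψ)
  rw [add_zero] at hlim
  have hconst : Tendsto (fun _ : ℝ => (∫ z, lerayVeryWeakIntegrand U W V ψ z) +
      ∫ z : ℝ × ℝ³, p z.1 z.2 * g z.1 z.2) atTop (𝓝 0) := by
    refine hlim.congr' ?_
    filter_upwards [eventually_gt_atTop 0] with r hr
    exact (key r hr).symm
  exact tendsto_nhds_unique tendsto_const_nhds hconst

end Main

end BradshawTsai2017

namespace BradshawTsai2017

/-! ### From slice-wise hypotheses to the space–time forms -/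

section Slices

variable {U W V : ℝ → ℝ³ → ℝ³} {p : ℝ → ℝ³ → ℝ}

/-- The slices of a space–time test function on `ℝ × ℝ³` are test functions on `ℝ³`. [folklore] -/
theorem isTestFunctionOn_slice {F : Type*} [NormedAddCommGroup F] [NormedSpace ℝ F]
    {θ : ℝ → ℝ³ → F} (hθ : IsSpaceTimeTestOn (⊤ : Opens (ℝ × ℝ³)) θ) (s : ℝ) :
    FunctionSpaces.IsTestFunctionOn (⊤ : Opens ℝ³) (θ s) :=
  ⟨hθ.contDiff_slice s, hθ.hasCompactSupport_slice s, fun _ _ => trivial⟩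

/-- **Space–time weak divergence-freeness of `u = U + W` from the slices**: if almost every slice
`U(s)` and almost every slice `W(s)` is weakly divergence free (`U`, `W` locally integrable on
`ℝ × ℝ³`), then `∫∫ ⟪U + W, ∇θ⟫ = 0` for every `θ ∈ C_c^∞(ℝ × ℝ³)` (Fubini). [folklore] -/
theorem integral_inner_add_gradient_eq_zero_of_ae (hU1 : LocallyIntegrable (uncurry U) volume)
    (hW1 : LocallyIntegrable (uncurry W) volume) (hUdiv : ∀ᵐ s : ℝ, IsWeaklyDivFree (U s))
    (hWdiv : ∀ᵐ s : ℝ, IsWeaklyDivFree (W s)) {θ : ℝ → ℝ³ → ℝ}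
    (hθ : IsSpaceTimeTestOn (⊤ : Opens (ℝ × ℝ³)) θ) :
    ∫ z : ℝ × ℝ³, ⟪U z.1 z.2 + W z.1 z.2, gradient (θ z.1) z.2⟫ = 0 := by
  obtain ⟨cg, -, hg0⟩ := hθ.continuous_gradient_field
  have hKQ : tsupport (uncurry θ) ⊆ ((⊤ : Opens (ℝ × ℝ³)) : Set (ℝ × ℝ³)) := fun _ _ => trivial
  have IU : Integrable (fun z : ℝ × ℝ³ => ⟪U z.1 z.2, gradient (θ z.1) z.2⟫) (volume : Measure (ℝ × ℝ³)) :=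
    integrable_inner_of_locallyIntegrableOn (hU1.locallyIntegrableOn _) cg hθ.hasCompactSupport hKQ hg0
  have IW : Integrable (fun z : ℝ × ℝ³ => ⟪W z.1 z.2, gradient (θ z.1) z.2⟫) (volume : Measure (ℝ × ℝ³)) :=
    integrable_inner_of_locallyIntegrableOn (hW1.locallyIntegrableOn _) cg hθ.hasCompactSupport hKQ hg0
  have hslice : ∀ {F : ℝ → ℝ³ → ℝ³}, (∀ᵐ s : ℝ, IsWeaklyDivFree (F s)) →
      Integrable (fun z : ℝ × ℝ³ => ⟪F z.1 z.2, gradient (θ z.1) z.2⟫) (volume : Measure (ℝ × ℝ³)) →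
      ∫ z : ℝ × ℝ³, ⟪F z.1 z.2, gradient (θ z.1) z.2⟫ = 0 := by
    intro F hF hI
    rw [show (volume : Measure (ℝ × ℝ³)) = (volume : Measure ℝ).prod (volume : Measure ℝ³) from rfl]
      at hI ⊢
    rw [integral_prod _ hI]
    refine integral_eq_zero_of_ae (hF.mono fun s hs => ?_)
    exact hs (θ s) (isTestFunctionOn_slice hθ s)
  simp_rw [inner_add_left]
  rw [integral_add IU IW, hslice hUdiv IU, hslice hWdiv IW, add_zero]

/-- **The space–time weak pressure Poisson equation from the slices**: if for almost every `s`
the slice `p(s)` solves `∫ p(s) Δφ = −∫ (D²φ(b(s), U(s)) + D²φ(u(s), W(s)))` for all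
`φ ∈ C_c^∞(ℝ³)` (`u = U + W`, `b = W + V`; this is what "`p(s)` is the Riesz pressure
`Σ RᵢRⱼ(bᵢUⱼ + uᵢWⱼ)(s)`" means), then the space–time form holds for every
`θ ∈ C_c^∞(ℝ × ℝ³)` (Fubini; `U`, `W`, `V` with locally integrable squares). [folklore] -/
theorem integral_pressure_mul_laplacian_eq_of_ae (hU1 : LocallyIntegrable (uncurry U) volume)
    (hW1 : LocallyIntegrable (uncurry W) volume) (hV1 : LocallyIntegrable (uncurry V) volume)
    (hU2 : LocallyIntegrable (fun z => ‖uncurry U z‖ ^ 2) volume)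
    (hW2 : LocallyIntegrable (fun z => ‖uncurry W z‖ ^ 2) volume)
    (hV2 : LocallyIntegrable (fun z => ‖uncurry V z‖ ^ 2) volume)
    (hp1 : LocallyIntegrable (uncurry p) volume)
    (hps : ∀ᵐ s : ℝ, ∀ φ : ℝ³ → ℝ, ContDiff ℝ (⊤ : ℕ∞) φ → HasCompactSupport φ →
      ∫ y, p s y * Δ φ y = -∫ y, (fderiv ℝ (fderiv ℝ φ) y (W s y + V s y) (U s y) +
        fderiv ℝ (fderiv ℝ φ) y (U s y + W s y) (W s y)))
    {θ : ℝ → ℝ³ → ℝ} (hθ : IsSpaceTimeTestOn (⊤ : Opens (ℝ × ℝ³)) θ) :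
    ∫ z : ℝ × ℝ³, p z.1 z.2 * Δ (θ z.1) z.2 =
      -∫ z : ℝ × ℝ³, (fderiv ℝ (fderiv ℝ (θ z.1)) z.2 (W z.1 z.2 + V z.1 z.2) (U z.1 z.2) +
        fderiv ℝ (fderiv ℝ (θ z.1)) z.2 (U z.1 z.2 + W z.1 z.2) (W z.1 z.2)) := by
  have hKQ : tsupport (uncurry θ) ⊆ ((⊤ : Opens (ℝ × ℝ³)) : Set (ℝ × ℝ³)) := fun _ _ => trivial
  have hlap := hθ.laplacian_top
  have Ipl : Integrable (fun z : ℝ × ℝ³ => p z.1 z.2 * Δ (θ z.1) z.2) (volume : Measure (ℝ × ℝ³)) :=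
    integrable_mul_of_locallyIntegrableOn (F := uncurry p) (hp1.locallyIntegrableOn _)
      (w := uncurry fun t => Δ (θ t)) hlap.contDiff.continuous hθ.hasCompactSupport hKQ
      fun z hz => laplacian_slice_eq_zero_of_notMem_tsupport hz
  have hθ2 : ∀ t, ContDiff ℝ 2 (θ t) := fun t => (hθ.contDiff_slice t).of_le (by norm_cast)
  obtain ⟨-, -, -, I4, I5⟩ := integrable_lerayVeryWeak_terms hU1 hW1 hV1 hU2 hW2 hV2
    hθ.gradient_isSpaceTimeTestOn
  have I45 : Integrable (fun z : ℝ × ℝ³ =>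
      fderiv ℝ (fderiv ℝ (θ z.1)) z.2 (W z.1 z.2 + V z.1 z.2) (U z.1 z.2) +
        fderiv ℝ (fderiv ℝ (θ z.1)) z.2 (U z.1 z.2 + W z.1 z.2) (W z.1 z.2))
      (volume : Measure (ℝ × ℝ³)) := by
    refine (I4.add I5).congr (Eventually.of_forall fun z => ?_)
    show ⟪U z.1 z.2, convect (W z.1 + V z.1) (fun y => gradient (θ z.1) y) z.2⟫ +
        ⟪W z.1 z.2, convect (U z.1 + W z.1) (fun y => gradient (θ z.1) y) z.2⟫ = _
    exact congrArg₂ (· + ·) (inner_fderiv_gradient_apply₂ (hθ2 z.1) z.2 _ _)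
      (inner_fderiv_gradient_apply₂ (hθ2 z.1) z.2 _ _)
  rw [show (volume : Measure (ℝ × ℝ³)) = (volume : Measure ℝ).prod (volume : Measure ℝ³) from rfl]
    at Ipl I45 ⊢
  rw [integral_prod _ Ipl, integral_prod _ I45, ← integral_neg]
  refine integral_congr_ae (hps.mono fun s hs => ?_)
  exact hs (θ s) (hθ.contDiff_slice s) (hθ.hasCompactSupport_slice s)

/-- **The [BT1] form of the theorem, from slice-wise data.** Let `U`, `V` be jointly measurable
with uniform slice bounds `∫ |U(s)|² ≤ C_U`, `∫ |V(s)|² ≤ C_V` (in [BT1]: `U = U_ε` with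
`‖U_ε‖_{L^∞L²} ≤ C`, and `V = η_ε * U_ε` by Young's inequality), let `W` be `C¹` with
divergence-free slices and `‖W(s)‖_{L^q} ≤ C_W` for some `2 ≤ q < ∞` (the revised profile of
Lemma 2.5, `q = 10/3`), let almost every slice `U(s)` be weakly divergence free, let `p` be a
pressure in `L^{q_p}` of time slabs, `1 ≤ q_p < ∞` (in [BT1]: `p̃_ε ∈ L^{5/3}(ℝ³ × [0,T])`,
periodic), whose slices solve the weak Poisson equation
`∫ p(s)Δφ = −∫ (D²φ(b(s),U(s)) + D²φ(u(s),W(s)))` for a.e. `s`, and let the very weak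
(divergence-free-tested) mollified perturbed Leray system hold on `ℝ × ℝ³`. Then `(u, p)`,
`u = U + W`, solves the system in the sense of distributions: the `distributional` clause of
`IsMollifiedPeriodicWeakSolution` (with `V = mollify η ε U`). [cite: BradshawTsai2017AHP, proof of Thm 2.4 ("∇(p_ε − p̃_ε) = 0. We may therefore replace p_ε by p̃_ε")] -/
theorem distributional_of_veryWeak_slices {CU CV CW : ℝ≥0∞} {q qp : ℝ≥0∞}
    (hUm : AEStronglyMeasurable (uncurry U) volume) (hCU : CU ≠ ⊤)
    (hU2 : ∀ s, ∫⁻ y, ‖U s y‖ₑ ^ 2 ≤ CU)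
    (hVm : AEStronglyMeasurable (uncurry V) volume) (hCV : CV ≠ ⊤)
    (hV2 : ∀ s, ∫⁻ y, ‖V s y‖ₑ ^ 2 ≤ CV)
    (hWc : ContDiff ℝ 1 (uncurry W)) (hWdiv : ∀ s, VectorCalculus.IsDivFree (W s))
    (hq : 2 ≤ q) (hq' : q ≠ ⊤) (hCW : CW ≠ ⊤) (hWq : ∀ s, eLpNorm (W s) q volume ≤ CW)
    (hUdiv : ∀ᵐ s : ℝ, IsWeaklyDivFree (U s))
    (hqp : 1 ≤ qp) (hqp' : qp ≠ ⊤)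
    (hp : ∀ a b : ℝ, MemLp (uncurry p) qp (volume.restrict (Icc a b ×ˢ (univ : Set ℝ³))))
    (hps : ∀ᵐ s : ℝ, ∀ φ : ℝ³ → ℝ, ContDiff ℝ (⊤ : ℕ∞) φ → HasCompactSupport φ →
      ∫ y, p s y * Δ φ y = -∫ y, (fderiv ℝ (fderiv ℝ φ) y (W s y + V s y) (U s y) +
        fderiv ℝ (fderiv ℝ φ) y (U s y + W s y) (W s y)))
    (hweak : ∀ ψ : ℝ → ℝ³ → ℝ³, IsSpaceTimeTestOn (⊤ : Opens (ℝ × ℝ³)) ψ →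
      (∀ t, VectorCalculus.IsDivFree (ψ t)) →
      ∫ z : ℝ × ℝ³, (⟪U z.1 z.2 + W z.1 z.2, timeDeriv ψ z.1 z.2⟫ +
        ⟪U z.1 z.2 + W z.1 z.2, Δ (ψ z.1) z.2⟫ -
        ⟪U z.1 z.2 + W z.1 z.2, (2 : ℝ) • ψ z.1 z.2 + fderiv ℝ (ψ z.1) z.2 z.2⟫ +
        ⟪U z.1 z.2, convect (W z.1 + V z.1) (ψ z.1) z.2⟫ +
        ⟪W z.1 z.2, convect (U z.1 + W z.1) (ψ z.1) z.2⟫) = 0)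
    {ψ : ℝ → ℝ³ → ℝ³} (hψ : IsSpaceTimeTestOn (⊤ : Opens (ℝ × ℝ³)) ψ) :
    ∫ z : ℝ × ℝ³, (⟪U z.1 z.2 + W z.1 z.2, timeDeriv ψ z.1 z.2⟫ +
      ⟪U z.1 z.2 + W z.1 z.2, Δ (ψ z.1) z.2⟫ -
      ⟪U z.1 z.2 + W z.1 z.2, (2 : ℝ) • ψ z.1 z.2 + fderiv ℝ (ψ z.1) z.2 z.2⟫ +
      ⟪U z.1 z.2, convect (W z.1 + V z.1) (ψ z.1) z.2⟫ +
      ⟪W z.1 z.2, convect (U z.1 + W z.1) (ψ z.1) z.2⟫ +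
      p z.1 z.2 * VectorCalculus.divergence (ψ z.1) z.2) = 0 := by
  -- the slab classes
  have two_eq : (2 : ℝ≥0∞).toReal = 2 := ENNReal.toReal_ofNat 2
  have hU : ∀ a b : ℝ, MemLp (uncurry U) 2 (volume.restrict (Icc a b ×ˢ (univ : Set ℝ³))) :=
    memLp_slab_of_forall_lintegral_le hUm two_ne_zero ENNReal.ofNat_ne_top hCU
      (fun s => by rw [two_eq]; exact_mod_cast hU2 s)
  have hV : ∀ a b : ℝ, MemLp (uncurry V) 2 (volume.restrict (Icc a b ×ˢ (univ : Set ℝ³))) :=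
    memLp_slab_of_forall_lintegral_le hVm two_ne_zero ENNReal.ofNat_ne_top hCV
      (fun s => by rw [two_eq]; exact_mod_cast hV2 s)
  have hq0 : q ≠ 0 := (zero_lt_two.trans_le hq).ne'
  have hW : ∀ a b : ℝ, MemLp (uncurry W) q (volume.restrict (Icc a b ×ˢ (univ : Set ℝ³))) :=
    memLp_slab_of_forall_eLpNorm_le hWc.continuous.aestronglyMeasurable hq0 hq' hCW hWq
  obtain ⟨hU1, hU2'⟩ := locallyIntegrable_and_sq_of_memLp_slab le_rfl hU
  obtain ⟨hW1, hW2'⟩ := locallyIntegrable_and_sq_of_memLp_slab hq hW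
  obtain ⟨hV1, hV2'⟩ := locallyIntegrable_and_sq_of_memLp_slab le_rfl hV
  have hp1 : LocallyIntegrable (uncurry p) volume := locallyIntegrable_of_memLp_slab hqp hp
  -- weak divergence-freeness of the `C¹` profile
  have hWdiv' : ∀ᵐ s : ℝ, IsWeaklyDivFree (W s) := Eventually.of_forall fun s =>
    VectorCalculus.IsDivFree.isWeaklyDivFree_holds (hWdiv s) (hWc.comp (contDiff_prodMk_right s))
  exact distributional_of_veryWeak le_rfl ENNReal.ofNat_ne_top hq hq' le_rfl ENNReal.ofNat_ne_top
    hqp hqp' hU hW hV hp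
    (fun θ hθ => integral_inner_add_gradient_eq_zero_of_ae hU1 hW1 hUdiv hWdiv' hθ)
    (fun θ hθ => integral_pressure_mul_laplacian_eq_of_ae hU1 hW1 hV1 hU2' hW2' hV2' hp1 hps hθ)
    hweak hψ

end Slices

end BradshawTsai2017

end Literature.Analysis.FluidPDE
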